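import Literature.Combinatorics.Optimization.MatchingPolytopeRelaxationScheme
import Literature.Barriers.PneNP.ExtendedFormulationCalculus
import HarnessLib

/-!
# Compact extended formulations for cardinality-restricted matching polytopes
# (Kaibel–Pashkovich–Theis 2012, §4: Theorem 14, Corollary 15, Theorem 16, Lemma 17, eq. (9)) — PROVED

V. Kaibel, K. Pashkovich, D. O. Theis, *Symmetry matters for sizes of extended formulations*,
SIAM J. Discrete Math. 26 (2012) 1361–1382 (IPCO 2010) = arXiv:0911.3712 [KaibelPashkovichTheis2012]
(held text `paper:arxiv-0911.3712`; locators are pages/lines of that rendering), §4 "A non-symmetric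
extension for `P^ℓ_match(n)`" (p0016).  `P^ℓ_match(n)` is the convex hull of the characteristic vectors
of the matchings of the complete graph `K_n` with EXACTLY `ℓ` edges (§1, p0004).  Verbatim:

> "Theorem 14. For all `n` and `ℓ`, there are extensions for `P^ℓ_match(n)` whose sizes can be bounded
> by `2^{O(ℓ)} n² log n` (and for which the encoding lengths of the coefficients needed to describe them
> can be bounded by a constant)."
> "Corollary 15. For all `n` and `ℓ ≤ O(log n)`, there are compact extended formulations for `P^ℓ_match(n)`."
> "Theorem 16 (Alon, Yuster, Zwick [AYZ95]). There are maps `φ_1, …, φ_{q(n,r)} : [n] → [r]` with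
> `q(n,r) ≤ 2^{O(r)} log n` such that, for every `W ⊆ [n]` with `|W| = r`, there is some `i ∈ [q(n,r)]`
> for which the map `φ_i` is bijective on `W`."
> "Lemma 17. If the polytopes `P_i ⊆ ℝ^m` (for `i ∈ [q]`) have extensions `Q_i` of size `s_i`,
> respectively, then `P = conv(P_1 ∪ ⋯ ∪ P_q)` has an extension of size `Σ_{i=1}^q (s_i + 1)`."
> "… let `φ_1, …, φ_q` be maps as guaranteed to exist by Theorem 16 with `r = 2ℓ` … and denote
> `M_i = {M ∈ M^ℓ(n) : φ_i is bijective on V(M)}` … `P^ℓ_match(n) = conv(P_1 ∪ ⋯ ∪ P_q)` (9) with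
> `P_i = conv{χ(M) : M ∈ M_i}` … one finds (see [KL10])
> `P_i = {x ∈ ℝ^E_+ : x_{E∖E_i} = 0, x(δ(φ_i⁻¹(s))) = 1 for all s ∈ [2ℓ],
>        x(δ(φ_i⁻¹(S))) ≥ 1 for all S ⊆ [2ℓ], |S| odd}`, where `E_i = E ∖ ⋃_{j ∈ [2ℓ]} E(φ_i⁻¹(j))`.
> As the sum of the number of variables and the number of inequalities in the description of `P_i` is
> bounded by `2^{O(ℓ)} + n²` …, we obtain an extension of `P^ℓ_match(n)` of size `2^{O(ℓ)} n² log n` by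
> Lemma 17."

The point of the source ("symmetry matters"): by its Theorem 9 / Corollary 10 (p0011; Yannakakis 1991, via
Bochert's theorem on primitive permutation groups) `P^ℓ_match(n)` has NO compact SYMMETRIC extended
formulation for `ℓ = Θ(log n)`, while Theorem 14 gives compact non-symmetric ones — the LP instance of
"lower bounds for symmetric formulations need not transfer to general ones" (cf. the cell's semidefinite
situation: the symmetric-SDP lower bound for matching, `SymmetricSDPMatching.lean`, is a theorem of the
tree, the general psd rank of the matching polytope is open).  The symmetric LOWER bound (Thms. 7, 9 / Cor. 10) is NOT
formalised here; this file proves the UPPER bound §4 completely, with explicit constants.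

## What is proved (no named facts; every statement a theorem)

§1 Perfect hashing (Theorem 16, existence form).
* `exists_hitting_family_frac` — the union bound as exact counting: if every `a ∈ P` is good for a
  `1/t` fraction of `B` and `|P| < 2^s`, some `t·s` members of `B` are good for all of `P`
  (`two_mul_pow_pred_le`: `(1 − 1/t)^t ≤ 1/2`).
* `factorial_mul_pow_le_card_injOn` — `≥ r!·r^{n−r}` of the maps `[n] → [r]` are injective on a fixed
  `r`-set; `pow_self_le_three_pow_mul_factorial` — `r^r ≤ 3^r r!`.
* **`exists_perfectHashFamily`** — Theorem 16 with `q ≤ 3^r · r · (⌊log₂ n⌋ + 1)`.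
  (AYZ's explicit constructions via [FKS84, SS90] are not formalised; the printed statement is the
  existence claim with the `2^{O(r)} log n` count, which is what is proved.)

§2–§3 The pieces.  `KEdge n` (edges of `K_n`), `cardMatchingVectors n ℓ` / **`cardMatchingPolytope n ℓ`**
(`P^ℓ_match(n)`, in the coordinates of the tree's `StephenTuncel1999.edmondsPolytope ⊤`), the block
indicator `inc φ e s t` (`e` runs between the colour classes of `s ≠ t`), the block sums `agg φ x`
(a symmetric function on the colours `[k]`), **`colourfulPolytope φ`** = KPT's `P_i`, written as
`x ≥ 0`, `x = 0` on monochromatic edges, `IsOddCutPoint (agg φ x)` (Edmonds' description of the perfect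
matching polytope of the complete graph on the colours, the tree's `PerfectMatchingPolytope` vocabulary);
`colourfulPolytope_eq_setOf` (the inequality system `kptLHS/kptRHS` on `KptIndex n k`, `2|E| + 2k + 2^k`
rows) and **`hasEFOfSize_colourfulPolytope`** (`xc(P_i) ≤ 2|E(K_n)| + 2k + 2^k`).

§4–§5 "One finds (see [KL10])", done by hand.  For a perfect matching `σ` of the colours, `blk φ σ s`
(edges between the classes of `s` and `σ s`), the fibre sets `Good φ σ F` and their integralization
(`good_subset_convexHull_good_empty`: every fibre point is a convex combination of SECTIONS, one edge per
block), `good_empty_subset_cardMatchingVectors` (sections are `ℓ`-matching vectors, `k = 2ℓ`),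
`good_subset_colourfulPolytope` (sections lie in `P_φ`: `agg = χ^σ`), `fibreSplit` and
**`colourfulPolytope_subset_convexHull_sections`** (the fibration over the perfect matching polytope of
the colours, using the tree's theorem `IsOddCutPoint.isPMConv`), **`colourfulPolytope_eq_convexHull_sections`**,
**`colourfulPolytope_subset_cardMatchingPolytope`**.

§6 `suppEdges`, `cover` (`V(M)`), `exists_mem_good_of_injOn` / **`mem_colourfulPolytope_of_injOn`**
(an `ℓ`-matching coloured injectively on `V(M)` lies in `P_φ`: the colour involution
`σ(φ u) = φ(mate u)`), `injOn_cover_of_mem_good`, **`sections_eq`** (sections = KPT's `M_i`) and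
**`colourfulPolytope_eq_convexHull_colourful`** (`P_i = conv{χ(M) : M ∈ M_i}` = the displayed system).

§7 **`cardMatchingPolytope_eq_convexHull_biUnion`** (eq. (9)), **`hasEFOfSize_cardMatchingPolytope`**
(Theorem 14: `xc(P^ℓ_match(n)) ≤ 9^ℓ · 2ℓ · (⌊log₂ n⌋+1) · (n² + 4ℓ + 4^ℓ + 2)`),
**`KaibelPashkovichTheis2012_thm14`** (`≤ 2^{9ℓ} · n² · (⌊log₂ n⌋ + 1)`, the printed shape
`2^{O(ℓ)} n² log n`) and **`KaibelPashkovichTheis2012_cor15`** (`ℓ ≤ c⌊log₂ n⌋ ⇒ xc ≤ n^{9c+3}`).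
Lemma 17 is the tree's `HasEFOfSize.convexHull_biUnion` (`ExtendedFormulationCalculus.lean`, with `+2`
instead of `+1` per piece in the slack-form currency — immaterial for the bounds).

WHAT THIS IS NOT: no lower bound of any kind (Theorems 7, 9, 18 and Corollaries 10, 19 of the source — the
symmetric lower bounds — are not formalised); nothing about the cycle polytopes of §5 (Theorem 20);
encoding lengths are not modelled by `HasEFOfSize`; nothing on psd rank or on P versus NP.

## References

* [KaibelPashkovichTheis2012] V. Kaibel, K. Pashkovich, D. O. Theis, *Symmetry matters for sizes of
  extended formulations*, SIAM J. Discrete Math. 26(3) (2012) 1361–1382, doi:10.1137/110839813,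
  arXiv:0911.3712 — §4, Thm. 14, Cor. 15, Thm. 16, Lemma 17, eq. (9) (p0016); §1 (p0004).
* [AlonYusterZwick1995] N. Alon, R. Yuster, U. Zwick, *Color-coding*, J. ACM 42 (1995) 844–856 — the
  perfect hash families quoted as Theorem 16 (only the probabilistic existence count is used here).
* [Edmonds1965] J. Edmonds, *Maximum matching and a polyhedron with 0,1-vertices*, J. Res. Nat. Bur.
  Standards 69B (1965) 125–130 — the matching vectors and the perfect matching polytope theorem (tree:
  `EdmondsMatchingPolytope.lean`, `PerfectMatchingPolytope.lean`).
* [Yannakakis1991] M. Yannakakis, *Expressing combinatorial optimization problems by linear programs*,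
  J. Comput. System Sci. 43 (1991) 441–466 — the symmetric lower bound (context only).
-/

noncomputable section

open Finset

namespace Literature.Combinatorics.Optimization

namespace CardMatchingEF

/-! ## §1. Small perfect-hash families (KPT Theorem 16, existence form of Alon–Yuster–Zwick) -/

/-- `2·(t−1)^t ≤ t^t` for `t ≥ 1`, i.e. `(1 − 1/t)^t ≤ e^{-1} ≤ 1/2`. [folklore] -/
private theorem two_mul_pow_pred_le (t : ℕ) (ht : 1 ≤ t) : 2 * (t - 1) ^ t ≤ t ^ t := by
  have htR : (0 : ℝ) < t := by exact_mod_cast ht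
  have h1 : ((1 : ℝ) - 1 / t) ^ t ≤ Real.exp (-1) :=
    Real.one_sub_div_pow_le_exp_neg (by exact_mod_cast ht)
  have h2 : Real.exp (-1) ≤ 1 / 2 := by
    rw [Real.exp_neg]
    have := Real.exp_one_gt_d9
    rw [inv_le_comm₀ (Real.exp_pos 1) (by norm_num)]
    linarith
  have h3 : (2 : ℝ) * ((t : ℝ) - 1) ^ t ≤ (t : ℝ) ^ t := by
    have h4 : ((t : ℝ) - 1) ^ t = (t : ℝ) ^ t * ((1 : ℝ) - 1 / t) ^ t := by
      rw [← mul_pow]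
      congr 1
      field_simp
    rw [h4]
    have h5 : (0 : ℝ) ≤ (t : ℝ) ^ t := by positivity
    nlinarith [mul_le_mul_of_nonneg_left (h1.trans h2) h5]
  have h6 : ((t - 1 : ℕ) : ℝ) = (t : ℝ) - 1 := by
    rw [Nat.cast_sub ht, Nat.cast_one]
  exact_mod_cast (show ((2 * (t - 1) ^ t : ℕ) : ℝ) ≤ ((t ^ t : ℕ) : ℝ) by
    push_cast [h6]; exact h3)

/-- **The union-bound covering argument, fraction form.**  If every `a ∈ P` is "good" for at least a
`1/t` fraction of a nonempty finite family `B` and `|P| < 2^s`, then some `t·s` members of `B` contain a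
good member for every `a ∈ P`: among the `|B|^{ts}` tuples `Fin (t s) → B` those missing a fixed `a`
number at most `((1 − 1/t)|B|)^{ts} ≤ 2^{-s}|B|^{ts}`. [cite: KaibelPashkovichTheis2012, Thm. 16 (p0016; the probabilistic existence argument behind [AYZ95])] -/
theorem exists_hitting_family_frac {α β : Type*} [DecidableEq β] (P : Finset α) (B : Finset β)
    (hB : B.Nonempty) (good : α → Finset β) (hgood : ∀ a ∈ P, good a ⊆ B) (t s : ℕ) (ht : 1 ≤ t)
    (hfrac : ∀ a ∈ P, B.card ≤ t * (good a).card) (hN : P.card < 2 ^ s) :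
    ∃ 𝒳 : Finset β, 𝒳 ⊆ B ∧ 𝒳.card ≤ t * s ∧ ∀ a ∈ P, ∃ X ∈ 𝒳, X ∈ good a := by
  classical
  set m : ℕ := t * s with hm
  set Ω : Finset (Fin m → β) := Fintype.piFinset fun _ => B with hΩ
  set bad : α → Finset (Fin m → β) := fun a => Fintype.piFinset fun _ => B \ good a with hbad_def
  have hΩcard : Ω.card = B.card ^ m := Fintype.card_piFinset_const _ _
  -- `t · |B \ good a| ≤ (t - 1) · |B|`
  have hbad1 : ∀ a ∈ P, t * (B \ good a).card ≤ (t - 1) * B.card := fun a ha => by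
    rw [card_sdiff_of_subset (hgood a ha), mul_tsub, tsub_mul, one_mul]
    exact Nat.sub_le_sub_left (hfrac a ha) _
  have hbad : ∀ a ∈ P, t ^ m * (bad a).card ≤ ((t - 1) * B.card) ^ m := fun a ha => by
    rw [hbad_def, Fintype.card_piFinset_const, ← mul_pow]
    exact Nat.pow_le_pow_left (hbad1 a ha) _
  have hlt : (P.biUnion bad).card < Ω.card := by
    have h1 : t ^ m * (P.biUnion bad).card ≤ P.card * ((t - 1) * B.card) ^ m :=
      calc t ^ m * (P.biUnion bad).card ≤ t ^ m * ∑ a ∈ P, (bad a).card :=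
            Nat.mul_le_mul_left _ card_biUnion_le
        _ = ∑ a ∈ P, t ^ m * (bad a).card := mul_sum _ _ _
        _ ≤ ∑ a ∈ P, ((t - 1) * B.card) ^ m := sum_le_sum hbad
        _ = P.card * ((t - 1) * B.card) ^ m := by rw [sum_const, smul_eq_mul]
    have hBpos : 0 < B.card := card_pos.2 hB
    have key : 2 ^ s * (t - 1) ^ m ≤ t ^ m := by
      rw [hm, pow_mul, pow_mul, ← mul_pow]
      exact Nat.pow_le_pow_left (two_mul_pow_pred_le t ht) s
    have hle : 2 ^ s * ((t - 1) * B.card) ^ m ≤ t ^ m * B.card ^ m := by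
      rw [mul_pow, ← mul_assoc]
      exact Nat.mul_le_mul_right _ key
    have h2 : P.card * ((t - 1) * B.card) ^ m < t ^ m * B.card ^ m := by
      rcases Nat.eq_zero_or_pos (((t - 1) * B.card) ^ m) with hX0 | hXpos
      · rw [hX0, mul_zero]
        exact Nat.mul_pos (Nat.pow_pos ht) (Nat.pow_pos hBpos)
      · exact lt_of_lt_of_le (Nat.mul_lt_mul_of_pos_right hN hXpos) hle
    have h3 : t ^ m * (P.biUnion bad).card < t ^ m * Ω.card := by
      rw [hΩcard]; exact lt_of_le_of_lt h1 h2
    exact Nat.lt_of_mul_lt_mul_left h3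
  obtain ⟨f, hfΩ, hfbad⟩ := exists_mem_notMem_of_card_lt_card hlt
  refine ⟨univ.image f, ?_, ?_, fun a ha => ?_⟩
  · intro X hX
    obtain ⟨i, -, rfl⟩ := mem_image.1 hX
    exact Fintype.mem_piFinset.1 hfΩ i
  · exact card_image_le.trans (by simp [hm])
  · have hnot : f ∉ bad a := fun h => hfbad (mem_biUnion.2 ⟨a, ha, h⟩)
    rw [hbad_def, Fintype.mem_piFinset] at hnot
    push Not at hnot
    obtain ⟨i, hi⟩ := hnot
    refine ⟨f i, mem_image.2 ⟨i, mem_univ _, rfl⟩, ?_⟩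
    have hfi : f i ∈ B := Fintype.mem_piFinset.1 hfΩ i
    by_contra hni
    exact hi (mem_sdiff.2 ⟨hfi, hni⟩)


/-- `r^r ≤ 3^r · r!` (from `r^r / r! ≤ e^r` and `e < 3`). [folklore] -/
private theorem pow_self_le_three_pow_mul_factorial (r : ℕ) : r ^ r ≤ 3 ^ r * r.factorial := by
  have h1 : ((r : ℝ) ^ r) / r.factorial ≤ Real.exp r :=
    Real.pow_div_factorial_le_exp (r : ℝ) (Nat.cast_nonneg r) r
  have h2 : Real.exp r ≤ (3 : ℝ) ^ r := by
    rw [show (r : ℝ) = (r : ℕ) * (1 : ℝ) by simp, Real.exp_nat_mul]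
    exact pow_le_pow_left₀ (Real.exp_pos 1).le (Real.exp_one_lt_d9.le.trans (by norm_num)) r
  have hf : (0 : ℝ) < r.factorial := by exact_mod_cast Nat.factorial_pos r
  have h3 : ((r : ℝ) ^ r) ≤ (3 : ℝ) ^ r * r.factorial := by
    rw [div_le_iff₀ hf] at h1
    nlinarith [h1, h2, hf.le]
  exact_mod_cast h3

/-- **Counting the maps that are injective on a fixed `r`-set**: at least `r! · r^{n−r}` of the `r^n`
maps `[n] → [r]` are injective (equivalently bijective) on a given `W ⊆ [n]` with `|W| = r` — the
injection `(σ, g) ↦ (σ on W, g off W)` from `(W ≃ [r]) × ([n] ∖ W → [r])`. [cite: KaibelPashkovichTheis2012, Thm. 16 (p0016)] -/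
theorem factorial_mul_pow_le_card_injOn {n r : ℕ} (W : Finset (Fin n)) (hW : W.card = r) :
    r.factorial * r ^ (n - r) ≤
      (univ.filter fun φ : Fin n → Fin r => Set.InjOn φ (W : Set (Fin n))).card := by
  classical
  have hcW : Fintype.card W = r := by rw [Fintype.card_coe, hW]
  let eW : W ≃ Fin r := Fintype.equivFinOfCardEq hcW
  let D := (W ≃ Fin r) × (↥(Wᶜ) → Fin r)
  let F : D → (Fin n → Fin r) := fun p v =>
    if h : v ∈ W then p.1 ⟨v, h⟩ else p.2 ⟨v, mem_compl.2 h⟩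
  have hD : Fintype.card D = r.factorial * r ^ (n - r) := by
    rw [Fintype.card_prod, Fintype.card_equiv eW, hcW, Fintype.card_fun, Fintype.card_fin,
      Fintype.card_coe, Finset.card_compl, hW, Fintype.card_fin]
  have hmaps : ∀ p : D, F p ∈ univ.filter fun φ : Fin n → Fin r => Set.InjOn φ (W : Set (Fin n)) := by
    intro p
    simp only [mem_filter, mem_univ, true_and]
    intro v hv w hw hvw
    have hv' : v ∈ W := hv
    have hw' : w ∈ W := hw
    simp only [F, dif_pos hv', dif_pos hw'] at hvw
    have := p.1.injective hvw
    simpa using this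
  have hinj : Function.Injective F := by
    rintro ⟨σ, g⟩ ⟨σ', g'⟩ h
    have hσ : σ = σ' := by
      refine Equiv.ext fun v => ?_
      have := congrFun h v
      simpa [F, dif_pos (show (v : Fin n) ∈ W from v.2)] using this
    have hg : g = g' := by
      funext v
      have hv : (v : Fin n) ∉ W := mem_compl.1 v.2
      have := congrFun h v
      simpa [F, dif_neg hv] using this
    rw [hσ, hg]
  calc r.factorial * r ^ (n - r) = (univ : Finset D).card := by rw [card_univ, hD]
    _ = ((univ : Finset D).image F).card := (card_image_of_injective _ hinj).symm
    _ ≤ _ := card_le_card (fun φ hφ => by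
        obtain ⟨p, -, rfl⟩ := mem_image.1 hφ
        exact hmaps p)

/-- **Kaibel–Pashkovich–Theis 2012, Theorem 16 (Alon–Yuster–Zwick [AYZ95]: small perfect-hash
families; existence form with an explicit count).**  For `1 ≤ r` and every `n` there are
`q ≤ 3^r · r · (⌊log₂ n⌋ + 1) = 2^{O(r)} log n` maps `φ₁, …, φ_q : [n] → [r]` such that every `W ⊆ [n]`
with `|W| = r` is mapped injectively (hence bijectively) onto `[r]` by some `φ_i`.  Proof: a uniformly
random map is injective on `W` with probability `r!/r^r ≥ 3^{-r}`, and `C(n,r) ≤ n^r < 2^{r(⌊log₂ n⌋+1)}`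
(`exists_hitting_family_frac`).  The printed theorem quotes the explicit constructions of [AYZ95] (via
[FKS84, SS90]); only existence, with this count, is proved here.
[cite: KaibelPashkovichTheis2012, Thm. 16 (p0016)] -/
theorem exists_perfectHashFamily (n r : ℕ) (hr : 1 ≤ r) :
    ∃ Φ : Finset (Fin n → Fin r), Φ.card ≤ 3 ^ r * (r * (Nat.log 2 n + 1)) ∧
      ∀ W : Finset (Fin n), W.card = r → ∃ φ ∈ Φ, Set.InjOn φ (W : Set (Fin n)) := by
  classical
  haveI : Nonempty (Fin r) := ⟨⟨0, hr⟩⟩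
  have hnL : n < 2 ^ (Nat.log 2 n + 1) := Nat.lt_pow_succ_log_self one_lt_two n
  have ht : 1 ≤ 3 ^ r := Nat.one_le_pow _ _ (by norm_num)
  have hBcard : (univ : Finset (Fin n → Fin r)).card = r ^ n := by
    rw [card_univ, Fintype.card_fun, Fintype.card_fin, Fintype.card_fin]
  have hfrac : ∀ W ∈ (univ : Finset (Fin n)).powersetCard r,
      (univ : Finset (Fin n → Fin r)).card ≤
        3 ^ r * (univ.filter fun φ : Fin n → Fin r => Set.InjOn φ (W : Set (Fin n))).card := by
    intro W hW
    have hWr : W.card = r := (mem_powersetCard.1 hW).2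
    have hrn : r ≤ n := by
      have := card_le_univ W
      rwa [hWr, Fintype.card_fin] at this
    calc (univ : Finset (Fin n → Fin r)).card = r ^ n := hBcard
      _ = r ^ r * r ^ (n - r) := by rw [← pow_add, Nat.add_sub_cancel' hrn]
      _ ≤ 3 ^ r * r.factorial * r ^ (n - r) :=
          Nat.mul_le_mul_right _ (pow_self_le_three_pow_mul_factorial r)
      _ = 3 ^ r * (r.factorial * r ^ (n - r)) := by ring
      _ ≤ _ := Nat.mul_le_mul_left _ (factorial_mul_pow_le_card_injOn W hWr)
  have hN : ((univ : Finset (Fin n)).powersetCard r).card < 2 ^ (r * (Nat.log 2 n + 1)) := by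
    rw [card_powersetCard, card_univ, Fintype.card_fin]
    calc n.choose r ≤ n ^ r := Nat.choose_le_pow n r
      _ < (2 ^ (Nat.log 2 n + 1)) ^ r := Nat.pow_lt_pow_left hnL (by omega)
      _ = 2 ^ (r * (Nat.log 2 n + 1)) := by rw [← pow_mul, mul_comm]
  obtain ⟨𝒳, -, hcard, hhit⟩ := exists_hitting_family_frac ((univ : Finset (Fin n)).powersetCard r)
    (univ : Finset (Fin n → Fin r)) univ_nonempty
    (fun W => univ.filter fun φ : Fin n → Fin r => Set.InjOn φ (W : Set (Fin n)))
    (fun _ _ => filter_subset _ _) (3 ^ r) (r * (Nat.log 2 n + 1)) ht hfrac hN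
  refine ⟨𝒳, hcard, fun W hW => ?_⟩
  obtain ⟨φ, hφ, hgood⟩ := hhit W (mem_powersetCard.2 ⟨subset_univ _, hW⟩)
  exact ⟨φ, hφ, (mem_filter.1 hgood).2⟩

/-! ## §2. Cardinality-restricted matching polytopes; colour classes, block sums, the pieces `P_φ` -/

/-- The edges of `K_n` (coordinates of the matching polytopes, as in `StephenTuncel1999.edmondsPolytope ⊤`). [cite: KaibelPashkovichTheis2012, §1 (p0004)] -/
abbrev KEdge (n : ℕ) : Type := (⊤ : SimpleGraph (Fin n)).edgeSet

open StephenTuncel1999 (matchingVectors)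
open PerfectMatchingPolytope (IsPM pmInd cut IsOddCutPoint IsPMConv)

variable {n k : ℕ}

/-- **`ℓ`-matching vectors**: characteristic vectors of the matchings of `K_n` with exactly `ℓ` edges
(Edmonds' matching vectors `matchingVectors ⊤` with coordinate sum `ℓ`). [cite: KaibelPashkovichTheis2012, §1 (p0004: "`M^ℓ(n)` the set of all matchings of cardinality `ℓ`")] -/
def cardMatchingVectors (n ℓ : ℕ) : Set (KEdge n → ℝ) :=
  {x | x ∈ matchingVectors (⊤ : SimpleGraph (Fin n)) ∧ ∑ e, x e = ℓ}

/-- **The cardinality-restricted matching polytope `P^ℓ_match(n) = conv{χ(M) : M ∈ M^ℓ(n)}`.**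
[cite: KaibelPashkovichTheis2012, §1 (p0004)] -/
def cardMatchingPolytope (n ℓ : ℕ) : Set (KEdge n → ℝ) :=
  convexHull ℝ (cardMatchingVectors n ℓ)

/-- Block indicator: the edge `e` runs between the colour classes `φ⁻¹(s)` and `φ⁻¹(t)`, `s ≠ t`
(`e ∈ E_i` with colour pair `{s,t}`). [cite: KaibelPashkovichTheis2012, §4 (p0016: "`E_i = E ∖ ⋃_j E(φ_i⁻¹(j))`")] -/
def inc (φ : Fin n → Fin k) (e : KEdge n) (s t : Fin k) : ℝ :=
  if Sym2.map φ (e : Sym2 (Fin n)) = s(s, t) ∧ s ≠ t then 1 else 0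

/-- **Block sums** `y_{st} = x(φ⁻¹(s) : φ⁻¹(t))`, as a symmetric function on colours with zero
diagonal (the vocabulary of the tree's perfect matching polytope on the colour set `[k]`).
[cite: KaibelPashkovichTheis2012, §4 (p0016: the constraints "`x(δ(φ_i⁻¹(s))) = 1`", "`x(δ(φ_i⁻¹(S))) ≥ 1`")] -/
def agg (φ : Fin n → Fin k) (x : KEdge n → ℝ) (s t : Fin k) : ℝ :=
  ∑ e, inc φ e s t * x e

/-- `e` is monochromatic under `φ` (lies inside a colour class, `e ∈ E(φ⁻¹(j))`). [cite: KaibelPashkovichTheis2012, §4 (p0016)] -/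
def IsMono (φ : Fin n → Fin k) (e : KEdge n) : Prop :=
  (Sym2.map φ (e : Sym2 (Fin n))).IsDiag

/-- **KPT's piece `P_i`** for the colouring `φ = φ_i : [n] → [k]`:
`{x ∈ ℝ^E_+ : x_{E∖E_i} = 0, x(δ(φ⁻¹(s))) = 1 (s ∈ [k]), x(δ(φ⁻¹(S))) ≥ 1 (S ⊆ [k], |S| odd)}`,
written as: `x ≥ 0`, `x = 0` on monochromatic edges, and the block-sum function `agg φ x` satisfies
Edmonds' description of the perfect matching polytope of the complete graph on the colours.
[cite: KaibelPashkovichTheis2012, §4 (p0016, display after (9))] -/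
def colourfulPolytope (φ : Fin n → Fin k) : Set (KEdge n → ℝ) :=
  {x | (∀ e, 0 ≤ x e) ∧ (∀ e, IsMono φ e → x e = 0) ∧ IsOddCutPoint (agg φ x)}

/-! ### Elementary properties of the block indicator -/

/-- The block indicator is symmetric in the two colours. [cite: KaibelPashkovichTheis2012, §4 (p0016, proof of Thm. 14: the pieces `P_i`)] -/
theorem inc_symm (φ : Fin n → Fin k) (e : KEdge n) (s t : Fin k) : inc φ e s t = inc φ e t s := by
  unfold inc
  rw [Sym2.eq_swap (a := s)]
  by_cases h : Sym2.map φ (e : Sym2 (Fin n)) = s(t, s) <;> simp [h, ne_comm]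

/-- No block on the diagonal. [cite: KaibelPashkovichTheis2012, §4 (p0016, proof of Thm. 14: the pieces `P_i`)] -/
theorem inc_self (φ : Fin n → Fin k) (e : KEdge n) (s : Fin k) : inc φ e s s = 0 := by
  simp [inc]

/-- The block indicator is nonnegative. [cite: KaibelPashkovichTheis2012, §4 (p0016, proof of Thm. 14: the pieces `P_i`)] -/
theorem inc_nonneg (φ : Fin n → Fin k) (e : KEdge n) (s t : Fin k) : 0 ≤ inc φ e s t := by
  unfold inc; split_ifs <;> norm_num

/-- The block indicator is `0/1`-valued. [cite: KaibelPashkovichTheis2012, §4 (p0016, proof of Thm. 14: the pieces `P_i`)] -/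
theorem inc_eq_zero_or_one (φ : Fin n → Fin k) (e : KEdge n) (s t : Fin k) :
    inc φ e s t = 0 ∨ inc φ e s t = 1 := by
  unfold inc; split_ifs <;> simp

/-- The block indicator is at most `1`. [cite: KaibelPashkovichTheis2012, §4 (p0016, proof of Thm. 14: the pieces `P_i`)] -/
theorem inc_le_one (φ : Fin n → Fin k) (e : KEdge n) (s t : Fin k) : inc φ e s t ≤ 1 := by
  rcases inc_eq_zero_or_one φ e s t with h | h <;> rw [h]; norm_num

/-- When the block indicator is `1`. [cite: KaibelPashkovichTheis2012, §4 (p0016, proof of Thm. 14: the pieces `P_i`)] -/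
theorem inc_eq_one_iff (φ : Fin n → Fin k) (e : KEdge n) (s t : Fin k) :
    inc φ e s t = 1 ↔ Sym2.map φ (e : Sym2 (Fin n)) = s(s, t) ∧ s ≠ t := by
  unfold inc; split_ifs with h <;> simp [h]

/-- A non-monochromatic edge lies in some block. [cite: KaibelPashkovichTheis2012, §4 (p0016)] -/
theorem exists_inc_eq_one (φ : Fin n → Fin k) {e : KEdge n} (he : ¬ IsMono φ e) :
    ∃ s t, inc φ e s t = 1 := by
  obtain ⟨q, hq⟩ := e
  induction q using Sym2.ind with
  | h u v =>
    refine ⟨φ u, φ v, (inc_eq_one_iff _ _ _ _).2 ⟨by simp, fun h => he ?_⟩⟩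
    simp [IsMono, h]

/-- A monochromatic edge lies in no block. [cite: KaibelPashkovichTheis2012, §4 (p0016)] -/
theorem inc_eq_zero_of_isMono (φ : Fin n → Fin k) {e : KEdge n} (he : IsMono φ e) (s t : Fin k) :
    inc φ e s t = 0 := by
  unfold inc
  rw [if_neg]
  rintro ⟨h1, h2⟩
  unfold IsMono at he
  rw [h1, Sym2.mk_isDiag_iff] at he
  exact h2 he

/-- Block sums are symmetric. [cite: KaibelPashkovichTheis2012, §4 (p0016, proof of Thm. 14: the pieces `P_i`)] -/
theorem agg_symm (φ : Fin n → Fin k) (x : KEdge n → ℝ) (s t : Fin k) : agg φ x s t = agg φ x t s := by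
  unfold agg; simp_rw [inc_symm φ _ s t]

/-- Block sums vanish on the diagonal. [cite: KaibelPashkovichTheis2012, §4 (p0016, proof of Thm. 14: the pieces `P_i`)] -/
theorem agg_self (φ : Fin n → Fin k) (x : KEdge n → ℝ) (s : Fin k) : agg φ x s s = 0 := by
  simp [agg, inc_self]

/-- Block sums of a nonnegative vector are nonnegative. [cite: KaibelPashkovichTheis2012, §4 (p0016, proof of Thm. 14: the pieces `P_i`)] -/
theorem agg_nonneg (φ : Fin n → Fin k) {x : KEdge n → ℝ} (hx : ∀ e, 0 ≤ x e) (s t : Fin k) :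
    0 ≤ agg φ x s t :=
  sum_nonneg fun e _ => mul_nonneg (inc_nonneg φ e s t) (hx e)

/-- `agg` is linear in `x`. [cite: KaibelPashkovichTheis2012, §4 (p0016, proof of Thm. 14: the pieces `P_i`)] -/
theorem agg_add_smul (φ : Fin n → Fin k) (x y : KEdge n → ℝ) (a b : ℝ) (s t : Fin k) :
    agg φ (a • x + b • y) s t = a * agg φ x s t + b * agg φ y s t := by
  simp only [agg, Pi.add_apply, Pi.smul_apply, smul_eq_mul, mul_sum, ← sum_add_distrib]
  refine sum_congr rfl fun e _ => by ring

/-- A coordinate is dominated by the sum of its block. [cite: KaibelPashkovichTheis2012, §4 (p0016)] -/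
theorem le_agg_of_inc_eq_one (φ : Fin n → Fin k) {x : KEdge n → ℝ} (hx : ∀ e, 0 ≤ x e) {e : KEdge n}
    {s t : Fin k} (h : inc φ e s t = 1) : x e ≤ agg φ x s t := by
  unfold agg
  have := single_le_sum (f := fun f => inc φ f s t * x f) (fun f _ => mul_nonneg (inc_nonneg φ f s t) (hx f))
    (mem_univ e)
  simpa [h] using this

/-- Points of `P_φ` lie in the unit cube. [cite: KaibelPashkovichTheis2012, §4 (p0016)] -/
theorem le_one_of_mem_colourfulPolytope {φ : Fin n → Fin k} {x : KEdge n → ℝ}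
    (hx : x ∈ colourfulPolytope φ) (e : KEdge n) : x e ≤ 1 := by
  obtain ⟨h0, hmono, hodd⟩ := hx
  by_cases he : IsMono φ e
  · rw [hmono e he]; norm_num
  · obtain ⟨s, t, hst⟩ := exists_inc_eq_one φ he
    calc x e ≤ agg φ x s t := le_agg_of_inc_eq_one φ h0 hst
      _ ≤ ∑ u, agg φ x s u := single_le_sum (f := fun u => agg φ x s u)
          (fun u _ => agg_nonneg φ h0 s u) (mem_univ t)
      _ = 1 := hodd.row s

/-! ## §3. `P_φ` is given by `2|E| + 2k + 2^k` inequalities, hence has an extended formulation of that size -/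

/-- Row functional `x ↦ Σ_t y_{st}(x) = x(δ(φ⁻¹(s)))`. [cite: KaibelPashkovichTheis2012, §4 (p0016)] -/
def rowVec (φ : Fin n → Fin k) (s : Fin k) : KEdge n → ℝ := fun e => ∑ t, inc φ e s t

/-- Cut functional `x ↦ y(δ(U))(x) = x(δ(φ⁻¹(U)))`. [cite: KaibelPashkovichTheis2012, §4 (p0016)] -/
def cutVec (φ : Fin n → Fin k) (U : Finset (Fin k)) : KEdge n → ℝ :=
  fun e => ∑ s ∈ U, ∑ t ∈ Uᶜ, inc φ e s t

/-- The row functional evaluates to the row sum of the block sums (`x(δ(φ⁻¹(s)))`). [cite: KaibelPashkovichTheis2012, §4 (p0016, proof of Thm. 14: the pieces `P_i`)] -/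
theorem rowVec_dotProduct (φ : Fin n → Fin k) (s : Fin k) (x : KEdge n → ℝ) :
    rowVec φ s ⬝ᵥ x = ∑ t, agg φ x s t := by
  simp only [dotProduct, rowVec, agg, sum_mul]
  exact sum_comm

/-- The cut functional evaluates to the cut value of the block sums (`x(δ(φ⁻¹(U)))`). [cite: KaibelPashkovichTheis2012, §4 (p0016, proof of Thm. 14: the pieces `P_i`)] -/
theorem cutVec_dotProduct (φ : Fin n → Fin k) (U : Finset (Fin k)) (x : KEdge n → ℝ) :
    cutVec φ U ⬝ᵥ x = cut (agg φ x) U := by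
  simp only [dotProduct, cutVec, cut, agg, sum_mul]
  rw [sum_comm]
  refine sum_congr rfl fun s _ => ?_
  exact sum_comm

/-- Index set of the inequality description of `P_φ`: `−x_e ≤ 0` (`e ∈ E`); `x_e ≤ 0` for monochromatic
`e` (trivial otherwise); `±x(δ(φ⁻¹(s))) ≤ ±1` (`s ∈ [k]`); `−x(δ(φ⁻¹(U))) ≤ −1` for odd `U ⊆ [k]`
(trivial for even `U`). [cite: KaibelPashkovichTheis2012, §4 (p0016)] -/
abbrev KptIndex (n k : ℕ) : Type := KEdge n ⊕ KEdge n ⊕ Fin k ⊕ Fin k ⊕ Finset (Fin k)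

/-- Left-hand sides of the inequality description of `P_φ`. [cite: KaibelPashkovichTheis2012, §4 (p0016)] -/
def kptLHS (φ : Fin n → Fin k) : KptIndex n k → (KEdge n → ℝ)
  | Sum.inl e => fun f => if f = e then -1 else 0
  | Sum.inr (Sum.inl e) => by
      classical
      exact if IsMono φ e then (fun f => if f = e then 1 else 0) else 0
  | Sum.inr (Sum.inr (Sum.inl s)) => rowVec φ s
  | Sum.inr (Sum.inr (Sum.inr (Sum.inl s))) => -rowVec φ s
  | Sum.inr (Sum.inr (Sum.inr (Sum.inr U))) => if Odd U.card then -cutVec φ U else 0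

/-- Right-hand sides of the inequality description of `P_φ`. [cite: KaibelPashkovichTheis2012, §4 (p0016)] -/
def kptRHS : KptIndex n k → ℝ
  | Sum.inl _ => 0
  | Sum.inr (Sum.inl _) => 0
  | Sum.inr (Sum.inr (Sum.inl _)) => 1
  | Sum.inr (Sum.inr (Sum.inr (Sum.inl _))) => -1
  | Sum.inr (Sum.inr (Sum.inr (Sum.inr U))) => if Odd U.card then -1 else 0

/-- A coordinate functional. [folklore] -/
private theorem single_dotProduct (e : KEdge n) (c : ℝ) (x : KEdge n → ℝ) :
    (fun f : KEdge n => if f = e then c else 0) ⬝ᵥ x = c * x e := by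
  simp [dotProduct]

/-- **The inequality description of `P_φ`** (KPT's display): `P_φ = {x | kptLHS φ a · x ≤ kptRHS a ∀ a}`.
[cite: KaibelPashkovichTheis2012, §4 (p0016)] -/
theorem colourfulPolytope_eq_setOf (φ : Fin n → Fin k) :
    colourfulPolytope φ = {x | ∀ a : KptIndex n k, kptLHS φ a ⬝ᵥ x ≤ kptRHS a} := by
  classical
  ext x
  constructor
  · rintro ⟨h0, hmono, hodd⟩ a
    rcases a with e | e | s | s | U
    · simp only [kptLHS, kptRHS, single_dotProduct]; linarith [h0 e]
    · simp only [kptLHS, kptRHS]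
      split_ifs with he
      · rw [single_dotProduct, hmono e he]; norm_num
      · simp
    · simp only [kptLHS, kptRHS, rowVec_dotProduct, hodd.row s]; norm_num
    · simp only [kptLHS, kptRHS, neg_dotProduct, rowVec_dotProduct, hodd.row s]; norm_num
    · simp only [kptLHS, kptRHS]
      split_ifs with hU
      · rw [neg_dotProduct, cutVec_dotProduct]; linarith [hodd.oddCut U hU]
      · simp
  · intro h
    have h0 : ∀ e, 0 ≤ x e := fun e => by
      have := h (Sum.inl e)
      simp only [kptLHS, kptRHS, single_dotProduct] at this
      linarith
    have hmono : ∀ e, IsMono φ e → x e = 0 := fun e he => by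
      have := h (Sum.inr (Sum.inl e))
      simp only [kptLHS, kptRHS, if_pos he, single_dotProduct] at this
      linarith [h0 e]
    have hrow : ∀ s, ∑ t, agg φ x s t = 1 := fun s => by
      have h1 := h (Sum.inr (Sum.inr (Sum.inl s)))
      have h2 := h (Sum.inr (Sum.inr (Sum.inr (Sum.inl s))))
      simp only [kptLHS, kptRHS, neg_dotProduct, rowVec_dotProduct] at h1 h2
      linarith
    refine ⟨h0, hmono, ⟨fun u v => agg_symm φ x u v, fun v => agg_self φ x v,
      fun u v => agg_nonneg φ h0 u v, hrow, fun U hU => ?_⟩⟩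
    have := h (Sum.inr (Sum.inr (Sum.inr (Sum.inr U))))
    simp only [kptLHS, kptRHS, if_pos hU, neg_dotProduct, cutVec_dotProduct] at this
    linarith

open Literature.Barriers.PneNP (HasEFOfSize hasEFOfSize_of_inequalities)

/-- **Each piece `P_φ` has an extended formulation of size `2|E(K_n)| + 2k + 2^k`** ("the sum of the
number of variables and the number of inequalities in the description of `P_i` is bounded by
`2^{O(ℓ)} + n²`"). [cite: KaibelPashkovichTheis2012, §4 (p0016)] -/
theorem hasEFOfSize_colourfulPolytope (φ : Fin n → Fin k) :
    HasEFOfSize (colourfulPolytope φ) (2 * Fintype.card (KEdge n) + 2 * k + 2 ^ k) := by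
  classical
  have h := hasEFOfSize_of_inequalities (ι := KEdge n) (A := KptIndex n k) (kptLHS φ) kptRHS
  rw [← colourfulPolytope_eq_setOf] at h
  convert h using 1
  simp only [KptIndex, Fintype.card_sum, Fintype.card_fin, Fintype.card_finset]
  ring

/-! ## §4. Sections of a colour pattern: the integral points of `P_φ` generate its fibres

For a perfect matching `σ` of the colours (a fixed-point-free involution of `[k]`), the BLOCK of the
colour `s` is the set of edges running between the classes `φ⁻¹(s)` and `φ⁻¹(σ s)` (the block of `s`
and of `σ s` coincide).  The fibre of `P_φ` over the vertex `χ^σ` of the perfect matching polytope of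
the colours is the product of the simplices on the blocks; its points are convex combinations of the
SECTIONS (one edge per block), which are `ℓ`-matching vectors, `ℓ = k/2`.  This is the integrality
mechanism behind KPT's "one finds (see [KL10])" (branched polyhedral systems), done here by hand.
-/

/-- The block of colour `s` under the pattern `σ`: edges with colour pair `{s, σ s}`. [cite: KaibelPashkovichTheis2012, §4 (p0016)] -/
def blk (φ : Fin n → Fin k) (σ : Fin k → Fin k) (s : Fin k) : Finset (KEdge n) :=
  univ.filter fun e => inc φ e s (σ s) = 1

/-- Membership in a block. [cite: KaibelPashkovichTheis2012, §4 (p0016, proof of Thm. 14: the pieces `P_i`)] -/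
theorem mem_blk {φ : Fin n → Fin k} {σ : Fin k → Fin k} {s : Fin k} {e : KEdge n} :
    e ∈ blk φ σ s ↔ Sym2.map φ (e : Sym2 (Fin n)) = s(s, σ s) ∧ s ≠ σ s := by
  rw [blk, mem_filter, inc_eq_one_iff]; simp

/-- The blocks of `s` and `σ s` coincide. [cite: KaibelPashkovichTheis2012, §4 (p0016, proof of Thm. 14: the pieces `P_i`)] -/
theorem blk_eq_blk_apply {φ : Fin n → Fin k} {σ : Fin k → Fin k} (hσ : IsPM σ) (s : Fin k) :
    blk φ σ (σ s) = blk φ σ s := by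
  ext e
  rw [mem_blk, mem_blk, (hσ s).2, Sym2.eq_swap]
  constructor
  · rintro ⟨h1, h2⟩; exact ⟨h1, fun h => h2 h.symm⟩
  · rintro ⟨h1, h2⟩; exact ⟨h1, fun h => h2 h.symm⟩

/-- Two blocks are equal or disjoint: if `e` lies in the blocks of `s` and `s'` then the blocks agree. [cite: KaibelPashkovichTheis2012, §4 (p0016, proof of Thm. 14: the pieces `P_i`)] -/
theorem blk_eq_of_mem_of_mem {φ : Fin n → Fin k} {σ : Fin k → Fin k} (hσ : IsPM σ) {s s' : Fin k}
    {e : KEdge n} (hs : e ∈ blk φ σ s) (hs' : e ∈ blk φ σ s') : blk φ σ s' = blk φ σ s := by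
  rw [mem_blk] at hs hs'
  have h := hs.1.symm.trans hs'.1
  rw [Sym2.eq_iff] at h
  rcases h with ⟨h1, -⟩ | ⟨h1, -⟩
  · rw [h1]
  · rw [h1, blk_eq_blk_apply hσ]

/-- On the block of `s₀`, the indicator `s ↦ inc e s (σ s)` is the indicator of `{s₀, σ s₀}`. [cite: KaibelPashkovichTheis2012, §4 (p0016, proof of Thm. 14: the pieces `P_i`)] -/
theorem inc_apply_eq_ite {φ : Fin n → Fin k} {σ : Fin k → Fin k} (hσ : IsPM σ) {s₀ : Fin k}
    {e : KEdge n} (he : e ∈ blk φ σ s₀) (s : Fin k) :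
    inc φ e s (σ s) = if s = s₀ ∨ s = σ s₀ then 1 else 0 := by
  classical
  by_cases h : s = s₀ ∨ s = σ s₀
  · rw [if_pos h]
    rcases h with rfl | rfl
    · exact (mem_filter.1 he).2
    · have : e ∈ blk φ σ (σ s₀) := by rwa [blk_eq_blk_apply hσ]
      exact (mem_filter.1 this).2
  · rw [if_neg h]
    rcases inc_eq_zero_or_one φ e s (σ s) with h0 | h1
    · exact h0
    · exfalso
      have hmem : e ∈ blk φ σ s := mem_filter.2 ⟨mem_univ _, h1⟩
      have h2 := (mem_blk.1 he).1.symm.trans (mem_blk.1 hmem).1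
      rw [Sym2.eq_iff] at h2
      rcases h2 with ⟨h3, -⟩ | ⟨-, h3⟩
      · exact h (Or.inl h3.symm)
      · exact h (Or.inr h3.symm)

/-- A sum against that indicator picks out the two colours of the block. [cite: KaibelPashkovichTheis2012, §4 (p0016, proof of Thm. 14: the pieces `P_i`)] -/
theorem sum_inc_apply_mul {φ : Fin n → Fin k} {σ : Fin k → Fin k} (hσ : IsPM σ) {s₀ : Fin k}
    {e : KEdge n} (he : e ∈ blk φ σ s₀) (g : Fin k → ℝ) :
    ∑ s, inc φ e s (σ s) * g s = g s₀ + g (σ s₀) := by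
  classical
  simp_rw [inc_apply_eq_ite hσ he, ite_mul, one_mul, zero_mul]
  rw [sum_ite, sum_const_zero, add_zero]
  have hne : s₀ ≠ σ s₀ := (mem_blk.1 he).2
  have : (univ.filter fun s => s = s₀ ∨ s = σ s₀) = {s₀, σ s₀} := by
    ext s; simp
  rw [this, sum_pair hne]

/-- An edge lies in the block of `s` iff it lies in the block of `σ s`, so the block indicator summed
over all colours counts every block edge twice. [cite: KaibelPashkovichTheis2012, §4 (p0016, proof of Thm. 14: the pieces `P_i`)] -/
theorem sum_inc_apply_eq_two {φ : Fin n → Fin k} {σ : Fin k → Fin k} (hσ : IsPM σ) {s₀ : Fin k}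
    {e : KEdge n} (he : e ∈ blk φ σ s₀) : ∑ s, inc φ e s (σ s) = 2 := by
  have h := sum_inc_apply_mul hσ he (fun _ => (1 : ℝ))
  simp only [mul_one] at h
  rw [h]; norm_num

/-- **The partially integral fibre points** `Good φ σ F`: nonnegative, zero off the blocks of `σ`,
every block sum equal to `1`, and `0/1`-valued on the blocks of the colours outside `F` (and their
partners). `F = univ` is the whole fibre, `F = ∅` the set of sections. [folklore] -/
def Good (φ : Fin n → Fin k) (σ : Fin k → Fin k) (F : Finset (Fin k)) : Set (KEdge n → ℝ) :=
  {z | (∀ e, 0 ≤ z e) ∧ (∀ e, (∀ s, e ∉ blk φ σ s) → z e = 0) ∧ (∀ s, ∑ e ∈ blk φ σ s, z e = 1) ∧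
    (∀ s, s ∉ F → σ s ∉ F → ∀ e ∈ blk φ σ s, z e = 0 ∨ z e = 1)}

/-- Replacing the block of `s₀` by the indicator of one of its edges. [folklore] -/
def integralize (φ : Fin n → Fin k) (σ : Fin k → Fin k) (s₀ : Fin k) (z : KEdge n → ℝ) (e : KEdge n) :
    KEdge n → ℝ :=
  fun f => if f ∈ blk φ σ s₀ then (if f = e then 1 else 0) else z f

/-- The integralized point is again a (more integral) fibre point. [cite: KaibelPashkovichTheis2012, §4 (p0016, proof of Thm. 14: the pieces `P_i`)] -/
theorem integralize_mem_good {φ : Fin n → Fin k} {σ : Fin k → Fin k} (hσ : IsPM σ) {F : Finset (Fin k)}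
    {s₀ : Fin k} {z : KEdge n → ℝ} (hz : z ∈ Good φ σ (insert s₀ (insert (σ s₀) F)))
    {e : KEdge n} (he : e ∈ blk φ σ s₀) : integralize φ σ s₀ z e ∈ Good φ σ F := by
  classical
  obtain ⟨h0, hoff, hsum, hint⟩ := hz
  refine ⟨fun f => ?_, fun f hf => ?_, fun s => ?_, fun s hsF hσsF f hf => ?_⟩
  · unfold integralize
    by_cases h1 : f ∈ blk φ σ s₀
    · rw [if_pos h1]; split_ifs <;> norm_num
    · rw [if_neg h1]; exact h0 f
  · unfold integralize; rw [if_neg (hf s₀)]; exact hoff f hf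
  · -- block sums
    by_cases hbs : blk φ σ s = blk φ σ s₀
    · rw [hbs]
      have : ∀ f ∈ blk φ σ s₀, integralize φ σ s₀ z e f = if f = e then 1 else 0 := fun f hf => by
        unfold integralize; rw [if_pos hf]
      rw [sum_congr rfl this, sum_ite_eq' (blk φ σ s₀) e, if_pos he]
    · have : ∀ f ∈ blk φ σ s, integralize φ σ s₀ z e f = z f := fun f hf => by
        unfold integralize
        rw [if_neg]
        intro hf0
        exact hbs (blk_eq_of_mem_of_mem hσ hf0 hf)
      rw [sum_congr rfl this]
      exact hsum s
  · -- integrality outside `F`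
    unfold integralize
    by_cases hf0 : f ∈ blk φ σ s₀
    · rw [if_pos hf0]; split_ifs <;> simp
    · rw [if_neg hf0]
      have hs0 : s ≠ s₀ := by rintro rfl; exact hf0 hf
      have hs1 : s ≠ σ s₀ := by
        rintro rfl; rw [blk_eq_blk_apply hσ] at hf; exact hf0 hf
      have hs2 : σ s ≠ s₀ := by
        intro h; apply hs1; rw [← h, (hσ s).2]
      have hs3 : σ s ≠ σ s₀ := by
        intro h; apply hs0
        have := congrArg σ h; rwa [(hσ s).2, (hσ s₀).2] at this
      exact hint s (by simp [hs0, hs1, hsF]) (by simp [hs2, hs3, hσsF]) f hf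

/-- **One integralization step**: a fibre point is a convex combination (weights = its entries on the
block of `s₀`) of the points obtained by integralizing that block. [cite: KaibelPashkovichTheis2012, §4 (p0016, proof of Thm. 14: the pieces `P_i`)] -/
theorem good_insert_subset_convexHull {φ : Fin n → Fin k} {σ : Fin k → Fin k} (hσ : IsPM σ)
    (F : Finset (Fin k)) (s₀ : Fin k) :
    Good φ σ (insert s₀ (insert (σ s₀) F)) ⊆ convexHull ℝ (Good φ σ F) := by
  classical
  intro z hz
  have h0 := hz.1
  have hsum := hz.2.2.1
  -- `z = Σ_{e ∈ blk s₀} z e • integralize … e`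
  have hcomb : z = ∑ e ∈ blk φ σ s₀, z e • integralize φ σ s₀ z e := by
    funext f
    simp only [Finset.sum_apply, Pi.smul_apply, smul_eq_mul, integralize]
    by_cases hf : f ∈ blk φ σ s₀
    · simp only [if_pos hf, mul_ite, mul_one, mul_zero]
      rw [sum_ite_eq (blk φ σ s₀) f, if_pos hf]
    · simp only [if_neg hf, ← sum_mul, hsum s₀, one_mul]
  rw [hcomb]
  exact (convex_convexHull ℝ _).sum_mem (fun e _ => h0 e) (hsum s₀)
    fun e he => subset_convexHull ℝ _ (integralize_mem_good hσ hz he)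

/-- **The fibre is generated by its sections**: every fibre point (any `F`) is a convex combination of
sections (`F = ∅`). [cite: KaibelPashkovichTheis2012, §4 (p0016, proof of Thm. 14: the pieces `P_i`)] -/
theorem good_subset_convexHull_good_empty {φ : Fin n → Fin k} {σ : Fin k → Fin k} (hσ : IsPM σ)
    (F : Finset (Fin k)) : Good φ σ F ⊆ convexHull ℝ (Good φ σ ∅) := by
  classical
  induction F using Finset.induction_on with
  | empty => exact subset_convexHull ℝ _
  | insert s₀ F hs₀ ih =>
    -- `Good (insert s₀ F) ⊆ Good (insert s₀ (insert (σ s₀) F))` (fewer integrality constraints)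
    have hmono : Good φ σ (insert s₀ F) ⊆ Good φ σ (insert s₀ (insert (σ s₀) F)) := by
      rintro z ⟨h0, hoff, hsum, hint⟩
      refine ⟨h0, hoff, hsum, fun s hs hσs f hf => hint s ?_ ?_ f hf⟩
      · simp only [mem_insert, not_or] at hs ⊢; exact ⟨hs.1, hs.2.2⟩
      · simp only [mem_insert, not_or] at hσs ⊢; exact ⟨hσs.1, hσs.2.2⟩
    calc Good φ σ (insert s₀ F) ⊆ Good φ σ (insert s₀ (insert (σ s₀) F)) := hmono
      _ ⊆ convexHull ℝ (Good φ σ F) := good_insert_subset_convexHull hσ F s₀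
      _ ⊆ convexHull ℝ (Good φ σ ∅) := convexHull_min ih (convex_convexHull ℝ _)

/-- **The whole fibre**: nonnegative, zero off the blocks, all block sums `1`. [cite: KaibelPashkovichTheis2012, §4 (p0016, proof of Thm. 14: the pieces `P_i`)] -/
theorem mem_good_univ {φ : Fin n → Fin k} {σ : Fin k → Fin k} {z : KEdge n → ℝ} (h0 : ∀ e, 0 ≤ z e)
    (hoff : ∀ e, (∀ s, e ∉ blk φ σ s) → z e = 0) (hsum : ∀ s, ∑ e ∈ blk φ σ s, z e = 1) :
    z ∈ Good φ σ univ :=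
  ⟨h0, hoff, hsum, fun s hs => absurd (mem_univ s) hs⟩

/-! ### Sections are `ℓ`-matching vectors (`k = 2ℓ`) -/

/-- In a section, an edge with nonzero weight lies in a block. [cite: KaibelPashkovichTheis2012, §4 (p0016, proof of Thm. 14: the pieces `P_i`)] -/
theorem exists_mem_blk_of_ne_zero {φ : Fin n → Fin k} {σ : Fin k → Fin k} {F : Finset (Fin k)}
    {z : KEdge n → ℝ} (hz : z ∈ Good φ σ F) {e : KEdge n} (he : z e ≠ 0) : ∃ s, e ∈ blk φ σ s := by
  by_contra h
  push Not at h
  exact he (hz.2.1 e h)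

/-- The block containing an edge through `v` is the block of the colour of `v`. [cite: KaibelPashkovichTheis2012, §4 (p0016, proof of Thm. 14: the pieces `P_i`)] -/
theorem blk_eq_blk_colour {φ : Fin n → Fin k} {σ : Fin k → Fin k} (hσ : IsPM σ) {s : Fin k}
    {e : KEdge n} (he : e ∈ blk φ σ s) {v : Fin n} (hv : v ∈ (e : Sym2 (Fin n))) :
    blk φ σ s = blk φ σ (φ v) := by
  have hmap : φ v ∈ Sym2.map φ (e : Sym2 (Fin n)) := Sym2.mem_map.2 ⟨v, hv, rfl⟩
  rw [(mem_blk.1 he).1, Sym2.mem_iff] at hmap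
  rcases hmap with h | h
  · rw [h]
  · rw [h, blk_eq_blk_apply hσ]

/-- **Sections are matching vectors with `k/2` edges.** [cite: KaibelPashkovichTheis2012, §4 (p0016: "`M^ℓ(n) = M_1 ∪ ⋯ ∪ M_q`", the pieces consist of `ℓ`-matchings)] -/
theorem good_empty_subset_cardMatchingVectors {ℓ : ℕ} (hk : k = 2 * ℓ) {φ : Fin n → Fin k}
    {σ : Fin k → Fin k} (hσ : IsPM σ) : Good φ σ ∅ ⊆ cardMatchingVectors n ℓ := by
  classical
  rintro z ⟨h0, hoff, hsum, hint⟩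
  have h01 : ∀ e, z e = 0 ∨ z e = 1 := fun e => by
    by_cases he : z e = 0
    · exact Or.inl he
    · obtain ⟨s, hs⟩ := exists_mem_blk_of_ne_zero ⟨h0, hoff, hsum, hint⟩ he
      exact hint s (by simp) (by simp) e hs
  refine ⟨⟨h01, fun v => ?_⟩, ?_⟩
  · -- degree at `v`: all nonzero edges through `v` lie in the block of `φ v`
    calc ∑ e ∈ univ.filter (fun e : KEdge n => v ∈ (e : Sym2 (Fin n))), z e
        = ∑ e ∈ univ.filter (fun e : KEdge n => v ∈ (e : Sym2 (Fin n))),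
            (if e ∈ blk φ σ (φ v) then z e else 0) := by
          refine sum_congr rfl fun e he => ?_
          split_ifs with hb
          · rfl
          · by_contra hne
            obtain ⟨s, hs⟩ := exists_mem_blk_of_ne_zero ⟨h0, hoff, hsum, hint⟩ hne
            rw [blk_eq_blk_colour hσ hs (mem_filter.1 he).2] at hs
            exact hb hs
      _ = ∑ e ∈ (univ.filter (fun e : KEdge n => v ∈ (e : Sym2 (Fin n)))).filter
            (fun e => e ∈ blk φ σ (φ v)), z e := (sum_filter _ _).symm
      _ ≤ ∑ e ∈ blk φ σ (φ v), z e :=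
          sum_le_sum_of_subset_of_nonneg (fun e he => (mem_filter.1 he).2) fun e _ _ => h0 e
      _ = 1 := hsum (φ v)
  · -- cardinality: `2 Σ_e z e = Σ_s Σ_{e ∈ blk s} z e = k`
    have hblk : ∀ s, ∑ e ∈ blk φ σ s, z e = ∑ e, inc φ e s (σ s) * z e := fun s => by
      rw [blk, sum_filter]
      refine sum_congr rfl fun e _ => ?_
      rcases inc_eq_zero_or_one φ e s (σ s) with h | h <;> simp [h]
    have htwo : ∀ e, z e * ∑ s, inc φ e s (σ s) = z e * 2 := fun e => by
      by_cases he : z e = 0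
      · rw [he, zero_mul, zero_mul]
      · obtain ⟨s, hs⟩ := exists_mem_blk_of_ne_zero ⟨h0, hoff, hsum, hint⟩ he
        rw [sum_inc_apply_eq_two hσ hs]
    have hk' : (k : ℝ) = ∑ s : Fin k, ∑ e ∈ blk φ σ s, z e := by
      simp [hsum]
    simp_rw [hblk] at hk'
    rw [sum_comm] at hk'
    have : (k : ℝ) = 2 * ∑ e, z e := by
      rw [hk', mul_sum]
      refine sum_congr rfl fun e _ => ?_
      calc ∑ s, inc φ e s (σ s) * z e = z e * ∑ s, inc φ e s (σ s) := by
            rw [mul_sum]; exact sum_congr rfl fun s _ => mul_comm _ _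
        _ = z e * 2 := htwo e
        _ = 2 * z e := mul_comm _ _
    rw [hk] at this
    push_cast at this
    linarith

/-! ### Sections lie in `P_φ` -/

/-- The block sums of a section form the pattern `χ^σ`. [cite: KaibelPashkovichTheis2012, §4 (p0016, proof of Thm. 14: the pieces `P_i`)] -/
theorem agg_eq_pmInd_of_mem_good {φ : Fin n → Fin k} {σ : Fin k → Fin k} (hσ : IsPM σ)
    {F : Finset (Fin k)} {z : KEdge n → ℝ} (hz : z ∈ Good φ σ F) (s t : Fin k) :
    agg φ z s t = pmInd σ s t := by
  classical
  obtain ⟨h0, hoff, hsum, hint⟩ := hz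
  unfold agg pmInd
  by_cases hst : σ s = t
  · subst hst
    rw [if_pos rfl, ← hsum s, blk, sum_filter]
    refine sum_congr rfl fun e _ => ?_
    rcases inc_eq_zero_or_one φ e s (σ s) with h | h <;> simp [h]
  · rw [if_neg hst]
    refine sum_eq_zero fun e _ => ?_
    rcases inc_eq_zero_or_one φ e s t with h | h
    · rw [h, zero_mul]
    · -- an edge of colour pair `{s,t}`, `t ≠ σ s`, lies in no block
      rw [h, one_mul]
      refine hoff e fun s' hs' => ?_
      have h1 := ((inc_eq_one_iff φ e s t).1 h).1
      have h2 := (mem_blk.1 hs').1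
      rw [h1, Sym2.eq_iff] at h2
      rcases h2 with ⟨h3, h4⟩ | ⟨h3, h4⟩
      · exact hst (by rw [h3, h4])
      · apply hst; rw [h3, h4, (hσ s').2]

/-- **Sections (indeed all fibre points) lie in `P_φ`.** [cite: KaibelPashkovichTheis2012, §4 (p0016)] -/
theorem good_subset_colourfulPolytope {φ : Fin n → Fin k} {σ : Fin k → Fin k} (hσ : IsPM σ)
    (F : Finset (Fin k)) : Good φ σ F ⊆ colourfulPolytope φ := by
  intro z hz
  refine ⟨hz.1, fun e he => hz.2.1 e fun s hs => ?_, ?_⟩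
  · have := (mem_filter.1 hs).2
    rw [inc_eq_zero_of_isMono φ he] at this
    exact zero_ne_one this
  · have heq : agg φ z = pmInd σ := funext fun s => funext fun t => agg_eq_pmInd_of_mem_good hσ hz s t
    rw [heq]
    exact (PerfectMatchingPolytope.IsPM.isPMConv hσ).isOddCutPoint

/-! ## §5. The fibration of `P_φ` over the perfect matching polytope of the colours

`x ∈ P_φ` has block sums `y = agg φ x` in Edmonds' description on the colour set, so (the tree's perfect
matching polytope theorem `IsOddCutPoint.isPMConv`) `y = Σ_σ λ_σ χ^σ`; splitting `x` proportionally,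
`x = Σ_σ λ_σ x^σ` with `x^σ` in the fibre of `σ` (`x^σ_e = x_e / y_{ab}` on the edges of colour pair
`{a,b} ∈ σ`, zero elsewhere), and each fibre point is a convex combination of sections (§4).
-/

/-- **The sections of `φ`**: the integral fibre points over all colour patterns. [cite: KaibelPashkovichTheis2012, §4 (p0016)] -/
def sections (φ : Fin n → Fin k) : Set (KEdge n → ℝ) :=
  {z | ∃ σ : Fin k → Fin k, IsPM σ ∧ z ∈ Good φ σ ∅}

/-- The proportional split of `x` along the pattern `σ`:
`x^σ_e = x_e · N_σ(e) / D_σ(e)`, `N_σ(e) = Σ_s inc e s (σ s)` (`= 2` on the blocks of `σ`, else `0`),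
`D_σ(e) = Σ_s inc e s (σ s) · y_{s,σ s}` (`= 2 y_{ab}` on the block `{a,b}`). [folklore] -/
def fibreSplit (φ : Fin n → Fin k) (x : KEdge n → ℝ) (σ : Fin k → Fin k) : KEdge n → ℝ :=
  fun e => x e * (∑ s, inc φ e s (σ s)) / (∑ s, inc φ e s (σ s) * agg φ x s (σ s))

/-- Value of the split on a block edge. [cite: KaibelPashkovichTheis2012, §4 (p0016, proof of Thm. 14: the pieces `P_i`)] -/
theorem fibreSplit_of_mem_blk {φ : Fin n → Fin k} {σ : Fin k → Fin k} (hσ : IsPM σ) (x : KEdge n → ℝ)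
    {s₀ : Fin k} {e : KEdge n} (he : e ∈ blk φ σ s₀) :
    fibreSplit φ x σ e = x e / agg φ x s₀ (σ s₀) := by
  unfold fibreSplit
  rw [sum_inc_apply_eq_two hσ he, sum_inc_apply_mul hσ he (fun s => agg φ x s (σ s)), (hσ s₀).2,
    agg_symm φ x (σ s₀) s₀, ← two_mul, mul_comm (x e) 2, mul_div_mul_left _ _ (two_ne_zero)]

/-- Off the blocks of `σ` the split vanishes. [cite: KaibelPashkovichTheis2012, §4 (p0016, proof of Thm. 14: the pieces `P_i`)] -/
theorem fibreSplit_of_not_mem_blk {φ : Fin n → Fin k} {σ : Fin k → Fin k} (x : KEdge n → ℝ)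
    {e : KEdge n} (he : ∀ s, e ∉ blk φ σ s) : fibreSplit φ x σ e = 0 := by
  unfold fibreSplit
  have : ∀ s, inc φ e s (σ s) = 0 := fun s => by
    rcases inc_eq_zero_or_one φ e s (σ s) with h | h
    · exact h
    · exact absurd (show e ∈ blk φ σ s from mem_filter.2 ⟨mem_univ _, h⟩) (he s)
  simp [this]

/-- The block sum of `x` over the block of `s` is `y_{s, σ s}`. [cite: KaibelPashkovichTheis2012, §4 (p0016, proof of Thm. 14: the pieces `P_i`)] -/
theorem sum_blk_eq_agg (φ : Fin n → Fin k) (σ : Fin k → Fin k) (x : KEdge n → ℝ) (s : Fin k) :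
    ∑ e ∈ blk φ σ s, x e = agg φ x s (σ s) := by
  classical
  rw [blk, sum_filter, agg]
  refine sum_congr rfl fun e _ => ?_
  rcases inc_eq_zero_or_one φ e s (σ s) with h | h <;> simp [h]

/-- **The split lies in the fibre of `σ`** whenever `σ` carries positive weight in a decomposition of
the block sums (so that the block sums `y_{s,σ s}` are positive). [cite: KaibelPashkovichTheis2012, §4 (p0016, proof of Thm. 14: the pieces `P_i`)] -/
theorem fibreSplit_mem_good_univ {φ : Fin n → Fin k} {x : KEdge n → ℝ} (hx : x ∈ colourfulPolytope φ)
    {σ : Fin k → Fin k} (hσ : IsPM σ) (hpos : ∀ s, 0 < agg φ x s (σ s)) :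
    fibreSplit φ x σ ∈ Good φ σ univ := by
  classical
  have h0 := hx.1
  refine mem_good_univ (fun e => ?_) (fun e he => fibreSplit_of_not_mem_blk x he) (fun s => ?_)
  · unfold fibreSplit
    exact div_nonneg (mul_nonneg (h0 e) (sum_nonneg fun s _ => inc_nonneg φ e s (σ s)))
      (sum_nonneg fun s _ => mul_nonneg (inc_nonneg φ e s (σ s)) (agg_nonneg φ h0 s (σ s)))
  · have : ∀ e ∈ blk φ σ s, fibreSplit φ x σ e = x e / agg φ x s (σ s) := fun e he =>
      fibreSplit_of_mem_blk hσ x he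
    rw [sum_congr rfl this, ← sum_div, sum_blk_eq_agg, div_self (hpos s).ne']

/-- For an edge of colour pair `{a, b}` (`a ≠ b`): the block indicator is the indicator of `{a,b}`. [cite: KaibelPashkovichTheis2012, §4 (p0016, proof of Thm. 14: the pieces `P_i`)] -/
theorem inc_eq_ite_of_inc_eq_one {φ : Fin n → Fin k} {e : KEdge n} {a b : Fin k} (hab : inc φ e a b = 1)
    (s t : Fin k) : inc φ e s t = if s(s, t) = s(a, b) then 1 else 0 := by
  obtain ⟨hmap, hne⟩ := (inc_eq_one_iff φ e a b).1 hab
  by_cases h : s(s, t) = s(a, b)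
  · rw [if_pos h, inc_eq_one_iff, hmap, h]
    refine ⟨rfl, fun hst => ?_⟩
    rw [hst, Sym2.eq_iff] at h
    rcases h with ⟨h1, h2⟩ | ⟨h2, h1⟩ <;> exact hne (h1.symm.trans h2)
  · rw [if_neg h]
    rcases inc_eq_zero_or_one φ e s t with h0 | h1
    · exact h0
    · exact absurd (hmap.symm.trans ((inc_eq_one_iff φ e s t).1 h1).1).symm h

/-- Value of the split at an edge of colour pair `{a,b}`: `x_e / y_{ab}` if `σ a = b`, else `0`. [cite: KaibelPashkovichTheis2012, §4 (p0016, proof of Thm. 14: the pieces `P_i`)] -/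
theorem fibreSplit_eq_ite {φ : Fin n → Fin k} {σ : Fin k → Fin k} (hσ : IsPM σ) (x : KEdge n → ℝ)
    {e : KEdge n} {a b : Fin k} (hab : inc φ e a b = 1) :
    fibreSplit φ x σ e = if σ a = b then x e / agg φ x a b else 0 := by
  classical
  by_cases h : σ a = b
  · subst h
    have he : e ∈ blk φ σ a := mem_filter.2 ⟨mem_univ _, hab⟩
    rw [if_pos rfl, fibreSplit_of_mem_blk hσ x he]
  · rw [if_neg h]
    refine fibreSplit_of_not_mem_blk x fun s hs => ?_
    have h1 := (mem_filter.1 hs).2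
    rw [inc_eq_ite_of_inc_eq_one hab] at h1
    split_ifs at h1 with h2
    · rw [Sym2.eq_iff] at h2
      rcases h2 with ⟨rfl, h3⟩ | ⟨rfl, h3⟩
      · exact h h3
      · exact h (by rw [← h3, (hσ s).2])
    · exact zero_ne_one h1

/-- **The fibration**: every point of `P_φ` is a convex combination of sections.
[cite: KaibelPashkovichTheis2012, §4 (p0016: "`P_i = conv{χ(M) : M ∈ M_i}`" together with the display "one finds (see [KL10]) `P_i = {…}`")] -/
theorem colourfulPolytope_subset_convexHull_sections (φ : Fin n → Fin k) :
    colourfulPolytope φ ⊆ convexHull ℝ (sections φ) := by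
  classical
  intro x hx
  have h0 := hx.1
  have hmono := hx.2.1
  obtain ⟨wt, hwt0, hwtPM, hwt1, hy⟩ := hx.2.2.isPMConv
  set T : Finset (Fin k → Fin k) := univ.filter fun σ => wt σ ≠ 0 with hT
  have hTpm : ∀ σ ∈ T, IsPM σ := fun σ hσ => hwtPM σ (mem_filter.1 hσ).2
  have hTpos : ∀ σ ∈ T, 0 < wt σ := fun σ hσ => lt_of_le_of_ne (hwt0 σ) (Ne.symm (mem_filter.1 hσ).2)
  -- positivity of the block sums on the patterns that occur
  have hypos : ∀ σ ∈ T, ∀ s, 0 < agg φ x s (σ s) := by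
    intro σ hσ s
    rw [hy]
    calc (0 : ℝ) < wt σ * pmInd σ s (σ s) := by simp [pmInd, hTpos σ hσ]
      _ ≤ ∑ τ, wt τ * pmInd τ s (σ s) := single_le_sum (f := fun τ => wt τ * pmInd τ s (σ s))
          (fun τ _ => mul_nonneg (hwt0 τ) (PerfectMatchingPolytope.pmInd_nonneg τ _ _)) (mem_univ σ)
  -- the convex combination
  have hsumT : ∑ σ ∈ T, wt σ = 1 := by rw [hT, sum_filter_ne_zero, hwt1]
  have hcomb : x = ∑ σ ∈ T, wt σ • fibreSplit φ x σ := by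
    funext e
    simp only [Finset.sum_apply, Pi.smul_apply, smul_eq_mul]
    by_cases hxe : x e = 0
    · simp [fibreSplit, hxe]
    · have hne : ¬ IsMono φ e := fun hm => hxe (hmono e hm)
      obtain ⟨a, b, hab⟩ := exists_inc_eq_one φ hne
      have hyab : agg φ x a b ≠ 0 :=
        (lt_of_lt_of_le (lt_of_le_of_ne (h0 e) (Ne.symm hxe)) (le_agg_of_inc_eq_one φ h0 hab)).ne'
      have hval : ∀ σ ∈ T, wt σ * fibreSplit φ x σ e =
          (if σ a = b then wt σ else 0) * (x e / agg φ x a b) := fun σ hσ => by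
        rw [fibreSplit_eq_ite (hTpm σ hσ) x hab]
        split_ifs <;> simp
      rw [sum_congr rfl hval, ← sum_mul]
      have hw : ∑ σ ∈ T, (if σ a = b then wt σ else 0) = agg φ x a b := by
        rw [hy a b]
        have : ∑ σ ∈ T, (if σ a = b then wt σ else 0) = ∑ σ, (if σ a = b then wt σ else 0) := by
          rw [hT]
          refine (sum_subset (filter_subset _ _) fun σ _ hσ => ?_)
          have : wt σ = 0 := by simpa [mem_filter] using hσ
          simp [this]
        rw [this]
        refine sum_congr rfl fun σ _ => ?_
        unfold pmInd
        split_ifs <;> simp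
      rw [hw, mul_div_cancel₀ _ hyab]
  rw [hcomb]
  refine (convex_convexHull ℝ _).sum_mem (fun σ hσ => hwt0 σ) hsumT fun σ hσ => ?_
  have h1 : fibreSplit φ x σ ∈ Good φ σ univ := fibreSplit_mem_good_univ hx (hTpm σ hσ) (hypos σ hσ)
  have h2 := good_subset_convexHull_good_empty (hTpm σ hσ) univ h1
  exact convexHull_mono (show Good φ σ ∅ ⊆ sections φ from fun z hz => ⟨σ, hTpm σ hσ, hz⟩) h2

/-- **`P_φ` is the convex hull of its sections** (KPT's displayed description of `P_i`).
[cite: KaibelPashkovichTheis2012, §4 (p0016)] -/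
theorem colourfulPolytope_eq_convexHull_sections (φ : Fin n → Fin k) :
    colourfulPolytope φ = convexHull ℝ (sections φ) := by
  refine Set.Subset.antisymm (colourfulPolytope_subset_convexHull_sections φ) (convexHull_min ?_ ?_)
  · rintro z ⟨σ, hσ, hz⟩
    exact good_subset_colourfulPolytope hσ ∅ hz
  · -- convexity of `P_φ`
    intro x hx y hy a b ha hb hab
    refine ⟨fun e => ?_, fun e he => ?_, ?_⟩
    · simp only [Pi.add_apply, Pi.smul_apply, smul_eq_mul]
      exact add_nonneg (mul_nonneg ha (hx.1 e)) (mul_nonneg hb (hy.1 e))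
    · simp only [Pi.add_apply, Pi.smul_apply, smul_eq_mul, hx.2.1 e he, hy.2.1 e he]; ring
    · have heq : agg φ (a • x + b • y) = a • agg φ x + b • agg φ y := by
        funext s t
        simp only [agg_add_smul, Pi.add_apply, Pi.smul_apply, smul_eq_mul]
      rw [heq]
      exact PerfectMatchingPolytope.convex_oddCutPolytope hx.2.2 hy.2.2 ha hb hab

/-- **The pieces are contained in the cardinality-restricted matching polytope** (`k = 2ℓ`).
[cite: KaibelPashkovichTheis2012, §4 (p0016, eq. (9))] -/
theorem colourfulPolytope_subset_cardMatchingPolytope {ℓ : ℕ} (hk : k = 2 * ℓ) (φ : Fin n → Fin k) :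
    colourfulPolytope φ ⊆ cardMatchingPolytope n ℓ :=
  (colourfulPolytope_subset_convexHull_sections φ).trans
    (convexHull_mono fun _ ⟨_, hσ, hz⟩ => good_empty_subset_cardMatchingVectors hk hσ hz)


/-! ## §6. Colourful `ℓ`-matchings are sections: every `ℓ`-matching coloured injectively by `φ` lies in `P_φ`

For an `ℓ`-matching vector `x` whose `2ℓ = k` covered vertices receive pairwise distinct colours, the
colour classes are matched by `σ(φ u) = φ(mate u)`; `x` is then a section of `σ` ("`M_i = {M ∈ M^ℓ(n) :
φ_i is bijective on V(M)}`", "`P^ℓ_match(n) = conv(P_1 ∪ ⋯ ∪ P_q)`", eq. (9)).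
-/

open Classical in
/-- The edges of a `0/1` vector (the matching `M` with `x = χ(M)`). [cite: KaibelPashkovichTheis2012, §1 (p0004)] -/
def suppEdges (x : KEdge n → ℝ) : Finset (KEdge n) := univ.filter fun e => x e = 1

open Classical in
/-- The covered vertices `V(M)`. [cite: KaibelPashkovichTheis2012, §4 (p0016: "`φ_i` is bijective on `V(M)`")] -/
def cover (x : KEdge n → ℝ) : Finset (Fin n) :=
  univ.filter fun v => ∃ e ∈ suppEdges x, v ∈ (e : Sym2 (Fin n))

open Classical in
/-- The endpoints of an edge, as a finset. [folklore] -/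
def ends (e : KEdge n) : Finset (Fin n) := univ.filter fun v => v ∈ (e : Sym2 (Fin n))

/-- An edge of `K_n` has two endpoints. [folklore] -/
private theorem card_ends (e : KEdge n) : (ends e).card = 2 := by
  classical
  obtain ⟨q, hq⟩ := e
  induction q using Sym2.ind with
  | h u v =>
    have huv : u ≠ v := by
      rw [SimpleGraph.mem_edgeSet] at hq
      exact hq.ne
    have : ends ⟨s(u, v), hq⟩ = {u, v} := by
      ext w; simp [ends, Sym2.mem_iff]
    rw [this, card_pair huv]

/-- Membership in `V(M)`. [cite: KaibelPashkovichTheis2012, §4 (p0016, proof of Thm. 14: the pieces `P_i`)] -/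
theorem mem_cover {x : KEdge n → ℝ} {v : Fin n} :
    v ∈ cover x ↔ ∃ e ∈ suppEdges x, v ∈ (e : Sym2 (Fin n)) := by
  classical
  simp [cover]

/-- Membership in the support. [cite: KaibelPashkovichTheis2012, §4 (p0016, proof of Thm. 14: the pieces `P_i`)] -/
theorem mem_suppEdges {x : KEdge n → ℝ} {e : KEdge n} : e ∈ suppEdges x ↔ x e = 1 := by
  classical
  simp [suppEdges]

section matchingVector

variable {x : KEdge n → ℝ}

/-- A matching vector is the indicator of its support edges. [cite: Edmonds1965, §2 (p. 126)] -/
theorem eq_ite_of_mem_matchingVectors (hx : x ∈ matchingVectors (⊤ : SimpleGraph (Fin n))) (e : KEdge n) :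
    x e = if e ∈ suppEdges x then 1 else 0 := by
  rcases hx.1 e with h | h
  · rw [h, if_neg]; rw [mem_suppEdges, h]; norm_num
  · rw [if_pos (mem_suppEdges.2 h), h]

/-- **Matching property**: two support edges through a common vertex coincide (`x(δ(v)) ≤ 1`).
[cite: Edmonds1965, §2 (2) (p. 125)] -/
theorem suppEdges_unique (hx : x ∈ matchingVectors (⊤ : SimpleGraph (Fin n))) {e e' : KEdge n}
    (he : e ∈ suppEdges x) (he' : e' ∈ suppEdges x) {v : Fin n} (hv : v ∈ (e : Sym2 (Fin n)))
    (hv' : v ∈ (e' : Sym2 (Fin n))) : e = e' := by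
  classical
  by_contra hne
  have hdeg := hx.2 v
  have h2 : ∑ f ∈ ({e, e'} : Finset (KEdge n)), x f ≤
      ∑ f ∈ univ.filter (fun f : KEdge n => v ∈ (f : Sym2 (Fin n))), x f :=
    sum_le_sum_of_subset_of_nonneg (by
        intro f hf
        simp only [mem_insert, mem_singleton] at hf
        rcases hf with rfl | rfl <;> simp [hv, hv'])
      (fun f _ _ => by rcases hx.1 f with h | h <;> simp [h])
  rw [sum_pair hne, mem_suppEdges.1 he, mem_suppEdges.1 he'] at h2
  linarith

/-- `|V(M)| = 2|M|`. [cite: KaibelPashkovichTheis2012, §4 (p0016, proof of Thm. 14: the pieces `P_i`)] -/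
theorem card_cover (hx : x ∈ matchingVectors (⊤ : SimpleGraph (Fin n))) :
    (cover x).card = 2 * (suppEdges x).card := by
  classical
  have hcov : cover x = (suppEdges x).biUnion ends := by
    ext v; simp [mem_cover, ends]
  rw [hcov, card_biUnion]
  · simp [card_ends, mul_comm]
  · intro e he e' he' hne
    rw [Function.onFun, disjoint_left]
    intro v hv hv'
    exact hne (suppEdges_unique hx he he' (by simpa [ends] using hv) (by simpa [ends] using hv'))

/-- `|M| = ℓ` for an `ℓ`-matching vector. [cite: KaibelPashkovichTheis2012, §1 (p0004)] -/
theorem card_suppEdges {ℓ : ℕ} (hx : x ∈ cardMatchingVectors n ℓ) : (suppEdges x).card = ℓ := by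
  classical
  have h := hx.2
  have : ∑ e, x e = ((suppEdges x).card : ℝ) := by
    rw [sum_congr rfl fun e _ => eq_ite_of_mem_matchingVectors hx.1 e, sum_boole]
    simp [suppEdges]
  rw [this] at h
  exact_mod_cast h

/-- **Every `ℓ`-matching vector coloured injectively by `φ : [n] → [2ℓ]` is a section of `P_φ`.**
[cite: KaibelPashkovichTheis2012, §4 (p0016: "`M^ℓ(n) = M_1 ∪ ⋯ ∪ M_q`" and "`P_i = conv{χ(M) : M ∈ M_i}`")] -/
theorem exists_mem_good_of_injOn {ℓ : ℕ} (hk : k = 2 * ℓ) {φ : Fin n → Fin k}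
    (hx : x ∈ cardMatchingVectors n ℓ) (hφ : Set.InjOn φ (cover x : Set (Fin n))) :
    ∃ σ : Fin k → Fin k, IsPM σ ∧ x ∈ Good φ σ ∅ := by
  classical
  have hxm := hx.1
  -- `φ` maps the cover ONTO the colours
  have hsurj : ∀ s : Fin k, ∃ v ∈ cover x, φ v = s := by
    have h := Finset.surjOn_of_injOn_of_card_le (s := cover x) (t := (univ : Finset (Fin k))) φ
      (fun v _ => by simp) hφ (by rw [card_univ, Fintype.card_fin, card_cover hxm, card_suppEdges hx, hk])
    intro s
    obtain ⟨v, hv, hvs⟩ := h (by simp : s ∈ ((univ : Finset (Fin k)) : Set (Fin k)))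
    exact ⟨v, hv, hvs⟩
  choose vtx hvmem hvcol using hsurj
  have hex : ∀ v ∈ cover x, ∃ e ∈ suppEdges x, v ∈ (e : Sym2 (Fin n)) := fun v hv => mem_cover.1 hv
  choose edgeAt hEsupp hEmem using hex
  -- the partner of a covered vertex (identity elsewhere)
  let mate : Fin n → Fin n := fun v => if hv : v ∈ cover x then Sym2.Mem.other (hEmem v hv) else v
  have hmate_spec : ∀ v (hv : v ∈ cover x), s(v, mate v) = (edgeAt v hv : Sym2 (Fin n)) := by
    intro v hv
    simp only [mate, dif_pos hv]
    exact Sym2.other_spec _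
  have hmate_ne : ∀ v, v ∈ cover x → mate v ≠ v := by
    intro v hv
    simp only [mate, dif_pos hv]
    exact Sym2.other_ne (SimpleGraph.not_isDiag_of_mem_edgeSet _ (edgeAt v hv).2) _
  have hmate_cover : ∀ v, v ∈ cover x → mate v ∈ cover x := by
    intro v hv
    refine mem_cover.2 ⟨edgeAt v hv, hEsupp v hv, ?_⟩
    rw [← hmate_spec v hv]
    exact Sym2.mem_mk_right _ _
  -- every support edge through `v` is `edgeAt v`
  have hedge_eq : ∀ v (hv : v ∈ cover x) (e : KEdge n), e ∈ suppEdges x → v ∈ (e : Sym2 (Fin n)) →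
      e = edgeAt v hv := fun v hv e he hve =>
    suppEdges_unique hxm he (hEsupp v hv) hve (hEmem v hv)
  -- `vtx (φ v) = v` on the cover
  have hvtx : ∀ v, v ∈ cover x → vtx (φ v) = v := fun v hv =>
    hφ (hvmem (φ v)) hv (hvcol (φ v))
  -- mate is an involution on the cover
  have hmate_mate : ∀ v, v ∈ cover x → mate (mate v) = v := by
    intro v hv
    have hw := hmate_cover v hv
    have h1 : edgeAt v hv = edgeAt (mate v) hw :=
      hedge_eq (mate v) hw (edgeAt v hv) (hEsupp v hv)
        (by rw [← hmate_spec v hv]; exact Sym2.mem_mk_right _ _)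
    have h2 : s(mate v, mate (mate v)) = s(v, mate v) := by
      rw [hmate_spec (mate v) hw, ← h1, ← hmate_spec v hv]
    rw [Sym2.eq_iff] at h2
    rcases h2 with ⟨h3, _⟩ | ⟨_, h3⟩
    · exact absurd h3 (hmate_ne v hv)
    · exact h3
  -- the colour involution
  let σ : Fin k → Fin k := fun s => φ (mate (vtx s))
  have hσcol : ∀ v, v ∈ cover x → σ (φ v) = φ (mate v) := fun v hv => by
    show φ (mate (vtx (φ v))) = φ (mate v)
    rw [hvtx v hv]
  have hσ : IsPM σ := by
    intro s
    have hv := hvmem s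
    constructor
    · intro h
      have h' : φ (mate (vtx s)) = φ (vtx s) := h.trans (hvcol s).symm
      exact hmate_ne _ hv (hφ (hmate_cover _ hv) hv h')
    · show φ (mate (vtx (φ (mate (vtx s))))) = s
      rw [hvtx _ (hmate_cover _ hv), hmate_mate _ hv, hvcol s]
  -- support edges lie in the block of the colour of an endpoint
  have hblk_of_mem : ∀ e ∈ suppEdges x, ∀ v ∈ (e : Sym2 (Fin n)), e ∈ blk φ σ (φ v) := by
    intro e he v hve
    have hv : v ∈ cover x := mem_cover.2 ⟨e, he, hve⟩
    have hee : e = edgeAt v hv := hedge_eq v hv e he hve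
    rw [mem_blk, hσcol v hv, hee, ← hmate_spec v hv, Sym2.map_mk]
    exact ⟨rfl, fun h => (hσ (φ v)).1 ((hσcol v hv).trans h.symm)⟩
  refine ⟨σ, hσ, fun e => ?_, fun e he => ?_, fun s => ?_, fun s _ _ e _ => hxm.1 e⟩
  · rcases hxm.1 e with h | h <;> norm_num [h]
  · -- off the blocks `x` vanishes
    rcases hxm.1 e with h | h
    · exact h
    · exfalso
      obtain ⟨q, hq⟩ := e
      induction q using Sym2.ind with
      | h u w =>
        exact he (φ u) (hblk_of_mem _ (mem_suppEdges.2 h) u (Sym2.mem_mk_left _ _))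
  · -- block sums: the block of `s` contains exactly one support edge, `edgeAt (vtx s)`
    have hv := hvmem s
    have hone : (blk φ σ s).filter (fun e => e ∈ suppEdges x) = {edgeAt (vtx s) hv} := by
      ext e
      simp only [mem_filter, mem_singleton]
      constructor
      · rintro ⟨hb, he⟩
        -- an endpoint of colour `s`
        have hs : s ∈ Sym2.map φ (e : Sym2 (Fin n)) := by
          rw [(mem_blk.1 hb).1]; exact Sym2.mem_mk_left _ _
        obtain ⟨u, hue, hus⟩ := Sym2.mem_map.1 hs
        have hu : u ∈ cover x := mem_cover.2 ⟨e, he, hue⟩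
        have huv : u = vtx s := hφ hu hv (hus.trans (hvcol s).symm)
        subst huv
        exact hedge_eq _ hv e he hue
      · rintro rfl
        refine ⟨?_, hEsupp _ hv⟩
        have := hblk_of_mem _ (hEsupp _ hv) (vtx s) (hEmem _ hv)
        rwa [hvcol s] at this
    calc ∑ e ∈ blk φ σ s, x e = ∑ e ∈ blk φ σ s, (if e ∈ suppEdges x then 1 else 0) :=
          sum_congr rfl fun e _ => eq_ite_of_mem_matchingVectors hxm e
      _ = (((blk φ σ s).filter fun e => e ∈ suppEdges x).card : ℝ) := by
          rw [sum_boole]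
      _ = 1 := by rw [hone, card_singleton]; norm_num

/-- **Colourful `ℓ`-matching vectors lie in `P_φ`.** [cite: KaibelPashkovichTheis2012, §4 (p0016, eq. (9))] -/
theorem mem_colourfulPolytope_of_injOn {ℓ : ℕ} (hk : k = 2 * ℓ) {φ : Fin n → Fin k}
    (hx : x ∈ cardMatchingVectors n ℓ) (hφ : Set.InjOn φ (cover x : Set (Fin n))) :
    x ∈ colourfulPolytope φ := by
  obtain ⟨σ, hσ, hmem⟩ := exists_mem_good_of_injOn hk hx hφ
  exact good_subset_colourfulPolytope hσ ∅ hmem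

/-- **Sections are colourful**: `φ` is injective on the vertices covered by a section. [cite: KaibelPashkovichTheis2012, §4 (p0016: "`M_i = {M ∈ M^ℓ(n) : φ_i is bijective on V(M)}`")] -/
theorem injOn_cover_of_mem_good {φ : Fin n → Fin k} {σ : Fin k → Fin k} (hσ : IsPM σ)
    (hz : x ∈ Good φ σ ∅) : Set.InjOn φ (cover x : Set (Fin n)) := by
  classical
  obtain ⟨h0, hoff, hsum, hint⟩ := hz
  have h01 : ∀ e, x e = 0 ∨ x e = 1 := fun e => by
    by_cases he : x e = 0
    · exact Or.inl he
    · obtain ⟨s, hs⟩ := exists_mem_blk_of_ne_zero ⟨h0, hoff, hsum, hint⟩ he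
      exact hint s (by simp) (by simp) e hs
  -- a support edge through `v` lies in the block of `φ v`
  have hblk : ∀ e ∈ suppEdges x, ∀ v ∈ (e : Sym2 (Fin n)), e ∈ blk φ σ (φ v) := by
    intro e he v hv
    have hne : x e ≠ 0 := by rw [mem_suppEdges.1 he]; exact one_ne_zero
    obtain ⟨s, hs⟩ := exists_mem_blk_of_ne_zero ⟨h0, hoff, hsum, hint⟩ hne
    rwa [blk_eq_blk_colour hσ hs hv] at hs
  -- two support edges in one block coincide (the block sum is `1`)
  have huniq : ∀ s, ∀ e ∈ suppEdges x, ∀ e' ∈ suppEdges x, e ∈ blk φ σ s → e' ∈ blk φ σ s → e = e' := by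
    intro s e he e' he' hb hb'
    by_contra hne
    have h2 : ∑ f ∈ ({e, e'} : Finset (KEdge n)), x f ≤ ∑ f ∈ blk φ σ s, x f :=
      sum_le_sum_of_subset_of_nonneg (by
          intro f hf
          simp only [mem_insert, mem_singleton] at hf
          rcases hf with rfl | rfl
          · exact hb
          · exact hb')
        (fun f _ _ => h0 f)
    rw [sum_pair hne, mem_suppEdges.1 he, mem_suppEdges.1 he', hsum s] at h2
    linarith
  intro u hu w hw huw
  obtain ⟨e, he, hue⟩ := mem_cover.1 hu
  obtain ⟨e', he', hwe'⟩ := mem_cover.1 hw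
  have hb := hblk e he u hue
  have hb' := hblk e' he' w hwe'
  rw [← huw] at hb'
  have hee' : e = e' := huniq (φ u) e he e' he' hb hb'
  subst hee'
  -- `u, w` are endpoints of the same non-monochromatic edge with equal colours
  by_contra hne
  have hmap := (mem_blk.1 hb).1
  have hdiag : (Sym2.map φ (e : Sym2 (Fin n))).IsDiag := by
    obtain ⟨q, hq⟩ := e
    induction q using Sym2.ind with
    | h a b =>
      simp only [Sym2.mem_iff] at hue hwe'
      have hab : φ a = φ b := by
        rcases hue with rfl | rfl <;> rcases hwe' with rfl | rfl
        · exact absurd rfl hne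
        · exact huw
        · exact huw.symm
        · exact absurd rfl hne
      simp [hab]
  rw [hmap, Sym2.mk_isDiag_iff] at hdiag
  exact (hσ (φ u)).1 hdiag.symm

/-- **The sections of `φ` are exactly the `ℓ`-matching vectors on whose covered vertices `φ` is
injective** — KPT's `M_i`. [cite: KaibelPashkovichTheis2012, §4 (p0016)] -/
theorem sections_eq {ℓ : ℕ} (hk : k = 2 * ℓ) (φ : Fin n → Fin k) :
    sections φ = {x | x ∈ cardMatchingVectors n ℓ ∧ Set.InjOn φ (cover x : Set (Fin n))} := by
  ext x
  constructor
  · rintro ⟨σ, hσ, hz⟩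
    exact ⟨good_empty_subset_cardMatchingVectors hk hσ hz, injOn_cover_of_mem_good hσ hz⟩
  · rintro ⟨hx, hφ⟩
    obtain ⟨σ, hσ, hz⟩ := exists_mem_good_of_injOn hk hx hφ
    exact ⟨σ, hσ, hz⟩

/-- **KPT's pieces, literally: `P_i = conv{χ(M) : M ∈ M_i}`** equals the inequality-described
`colourfulPolytope φ_i`. [cite: KaibelPashkovichTheis2012, §4 (p0016: "one finds (see [KL10]) `P_i = {…}`")] -/
theorem colourfulPolytope_eq_convexHull_colourful {ℓ : ℕ} (hk : k = 2 * ℓ) (φ : Fin n → Fin k) :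
    colourfulPolytope φ =
      convexHull ℝ {x | x ∈ cardMatchingVectors n ℓ ∧ Set.InjOn φ (cover x : Set (Fin n))} := by
  rw [colourfulPolytope_eq_convexHull_sections, sections_eq hk]

end matchingVector

/-! ## §7. Assembly: Theorem 14 (with explicit constants) and Corollary 15 -/

/-- The `ℓ`-matching vectors form a finite set. [cite: KaibelPashkovichTheis2012, §4 (p0016, proof of Thm. 14: the pieces `P_i`)] -/
theorem cardMatchingVectors_finite (n ℓ : ℕ) : (cardMatchingVectors n ℓ).Finite := by
  classical
  refine (Set.finite_range (fun S : Finset (KEdge n) => fun e => if e ∈ S then (1 : ℝ) else 0)).subset ?_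
  rintro x ⟨hx, -⟩
  exact ⟨suppEdges x, funext fun e => (eq_ite_of_mem_matchingVectors hx e).symm⟩

/-- `P^ℓ_match(n)` is bounded. [cite: KaibelPashkovichTheis2012, §4 (p0016, proof of Thm. 14: the pieces `P_i`)] -/
theorem isBounded_cardMatchingPolytope (n ℓ : ℕ) : Bornology.IsBounded (cardMatchingPolytope n ℓ) :=
  isBounded_convexHull.2 (cardMatchingVectors_finite n ℓ).isBounded

/-- **Equation (9): `P^ℓ_match(n) = conv(P_1 ∪ ⋯ ∪ P_q)`** for any family of colourings `[n] → [2ℓ]`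
that is injective on every `2ℓ`-set. [cite: KaibelPashkovichTheis2012, §4 (p0016, eq. (9))] -/
theorem cardMatchingPolytope_eq_convexHull_biUnion {ℓ : ℕ} (hk : k = 2 * ℓ) (Φ : Finset (Fin n → Fin k))
    (hΦ : ∀ W : Finset (Fin n), W.card = k → ∃ φ ∈ Φ, Set.InjOn φ (W : Set (Fin n))) :
    cardMatchingPolytope n ℓ = convexHull ℝ (⋃ φ ∈ Φ, colourfulPolytope φ) := by
  apply Set.Subset.antisymm
  · refine convexHull_mono fun x hx => ?_
    have hW : (cover x).card = k := by rw [card_cover hx.1, card_suppEdges hx, hk]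
    obtain ⟨φ, hφ, hinj⟩ := hΦ (cover x) hW
    exact Set.mem_biUnion hφ (mem_colourfulPolytope_of_injOn hk hx hinj)
  · exact convexHull_min
      (Set.iUnion₂_subset fun φ _ => colourfulPolytope_subset_cardMatchingPolytope hk φ)
      (convex_convexHull ℝ _)

open Literature.Barriers.PneNP (HasPointedEFOfSize hasPointedEFOfSize_singleton)

/-- The empty set has an extended formulation of size `0` (Balas over the empty family). [folklore] -/
private theorem hasEFOfSize_empty : HasEFOfSize (∅ : Set (KEdge n → ℝ)) 0 := by
  have h := Literature.Barriers.PneNP.HasEFOfSize.convexHull_biUnion (ι := KEdge n)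
    (∅ : Finset Unit) (fun _ => ∅) (fun _ => 0) (fun _ h => absurd h (Finset.notMem_empty _))
    (fun _ h => absurd h (Finset.notMem_empty _))
  simpa using h

/-- `P^0_match(n) = {0}`. [cite: KaibelPashkovichTheis2012, §1 (p0004)] -/
theorem cardMatchingPolytope_zero (n : ℕ) : cardMatchingPolytope n 0 = {0} := by
  have : cardMatchingVectors n 0 = {0} := by
    ext x
    constructor
    · rintro ⟨hx, hsum⟩
      have h0 : ∀ e, 0 ≤ x e := fun e => by rcases hx.1 e with h | h <;> norm_num [h]
      rw [Nat.cast_zero, sum_eq_zero_iff_of_nonneg fun e _ => h0 e] at hsum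
      exact funext fun e => hsum e (mem_univ e)
    · rintro rfl
      refine ⟨⟨fun e => Or.inl rfl, fun v => ?_⟩, by simp⟩
      simp
  rw [cardMatchingPolytope, this, convexHull_singleton]

/-- For `n ≤ 1` (no edges) and `ℓ ≥ 1`, `P^ℓ_match(n) = ∅`. [cite: KaibelPashkovichTheis2012, §4 (p0016, proof of Thm. 14: the pieces `P_i`)] -/
theorem cardMatchingPolytope_eq_empty {n ℓ : ℕ} (hn : n ≤ 1) (hℓ : 1 ≤ ℓ) : cardMatchingPolytope n ℓ = ∅ := by
  have hE : IsEmpty (KEdge n) := by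
    refine ⟨fun e => ?_⟩
    obtain ⟨q, hq⟩ := e
    induction q using Sym2.ind with
    | h u v =>
      rw [SimpleGraph.mem_edgeSet] at hq
      exact hq.ne (Fin.ext (by omega))
  have : cardMatchingVectors n ℓ = ∅ := by
    ext x
    simp only [Set.mem_empty_iff_false, iff_false]
    rintro ⟨-, hsum⟩
    rw [univ_eq_empty, sum_empty] at hsum
    have : (ℓ : ℝ) = 0 := hsum.symm
    have : ℓ = 0 := by exact_mod_cast this
    omega
  rw [cardMatchingPolytope, this, convexHull_empty]

/-- `2|E(K_n)| ≤ n²`. [folklore] -/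
private theorem two_mul_card_KEdge_le (n : ℕ) : 2 * Fintype.card (KEdge n) ≤ n ^ 2 := by
  classical
  rw [← SimpleGraph.edgeFinset_card, SimpleGraph.card_edgeFinset_top_eq_card_choose_two,
    Fintype.card_fin, Nat.choose_two_right]
  have := Nat.div_mul_le_self (n * (n - 1)) 2
  calc 2 * (n * (n - 1) / 2) = n * (n - 1) / 2 * 2 := mul_comm _ _
    _ ≤ n * (n - 1) := this
    _ ≤ n ^ 2 := by rw [sq]; exact Nat.mul_le_mul_left _ (Nat.sub_le n 1)

/-- **Kaibel–Pashkovich–Theis 2012, Theorem 14 — PROVED with explicit constants.**  For all `n` and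
`ℓ`, the cardinality-restricted matching polytope `P^ℓ_match(n)` has an extended formulation of size at
most `9^ℓ · 2ℓ · (⌊log₂ n⌋ + 1) · (n² + 4ℓ + 4^ℓ + 2)` (`= 2^{O(ℓ)} n² log n`): `q ≤ 3^{2ℓ}·2ℓ·(⌊log₂ n⌋+1)`
colourings `[n] → [2ℓ]` injective on every `2ℓ`-set (Theorem 16), one piece `P_φ` of size
`≤ 2|E| + 4ℓ + 4^ℓ` per colouring (the display after (9)), glued by Balas' union construction
(Lemma 17, here with `+2` per piece in the tree's slack-form currency).  (The printed statement also
bounds the encoding length of the coefficients by a constant; all coefficients here are `0, ±1`, but the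
tree's `HasEFOfSize` does not record encoding lengths.)
[cite: KaibelPashkovichTheis2012, Thm. 14 (p0016)] -/
theorem hasEFOfSize_cardMatchingPolytope (n ℓ : ℕ) :
    ∃ r : ℕ, r ≤ 9 ^ ℓ * (2 * ℓ) * (Nat.log 2 n + 1) * (n ^ 2 + 4 * ℓ + 4 ^ ℓ + 2) ∧
      HasEFOfSize (cardMatchingPolytope n ℓ) r := by
  classical
  rcases Nat.eq_zero_or_pos ℓ with rfl | hℓ
  · refine ⟨0, Nat.zero_le _, ?_⟩
    rw [cardMatchingPolytope_zero]
    exact (hasPointedEFOfSize_singleton (0 : KEdge n → ℝ)).hasEFOfSize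
  · obtain ⟨Φ, hcard, hΦ⟩ := exists_perfectHashFamily n (2 * ℓ) (by omega)
    have heq := cardMatchingPolytope_eq_convexHull_biUnion (n := n) (k := 2 * ℓ) rfl Φ hΦ
    have hEF := Literature.Barriers.PneNP.HasEFOfSize.convexHull_biUnion Φ
      (fun φ => colourfulPolytope φ) (fun _ => 2 * Fintype.card (KEdge n) + 2 * (2 * ℓ) + 2 ^ (2 * ℓ))
      (fun φ _ => (isBounded_cardMatchingPolytope n ℓ).subset
        (colourfulPolytope_subset_cardMatchingPolytope (k := 2 * ℓ) rfl φ))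
      (fun φ _ => hasEFOfSize_colourfulPolytope φ)
    rw [← heq, sum_const, smul_eq_mul] at hEF
    refine ⟨_, ?_, hEF⟩
    have hE := two_mul_card_KEdge_le n
    have h4 : 2 ^ (2 * ℓ) = 4 ^ ℓ := by rw [pow_mul]; norm_num
    have h9 : 3 ^ (2 * ℓ) = 9 ^ ℓ := by rw [pow_mul]; norm_num
    calc Φ.card * (2 * Fintype.card (KEdge n) + 2 * (2 * ℓ) + 2 ^ (2 * ℓ) + 2)
        ≤ (3 ^ (2 * ℓ) * ((2 * ℓ) * (Nat.log 2 n + 1))) * (n ^ 2 + 4 * ℓ + 4 ^ ℓ + 2) :=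
          Nat.mul_le_mul hcard (by rw [h4]; omega)
      _ = 9 ^ ℓ * (2 * ℓ) * (Nat.log 2 n + 1) * (n ^ 2 + 4 * ℓ + 4 ^ ℓ + 2) := by rw [h9]; ring

/-- `4ℓ + 3 ≤ 2 · 4^ℓ` for `ℓ ≥ 1`. [folklore] -/
private theorem four_mul_add_three_le (ℓ : ℕ) (hℓ : 1 ≤ ℓ) : 4 * ℓ + 3 ≤ 2 * 4 ^ ℓ := by
  induction ℓ with
  | zero => omega
  | succ m ih =>
    rcases Nat.eq_zero_or_pos m with rfl | hm
    · norm_num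
    · have := ih hm
      rw [pow_succ]
      omega

/-- **Theorem 14 in the printed shape `2^{O(ℓ)} n² log n`**: `xc(P^ℓ_match(n)) ≤ 2^{9ℓ} · n² · (⌊log₂ n⌋ + 1)`.
[cite: KaibelPashkovichTheis2012, Thm. 14 (p0016)] -/
theorem KaibelPashkovichTheis2012_thm14 (n ℓ : ℕ) :
    ∃ r : ℕ, r ≤ 2 ^ (9 * ℓ) * n ^ 2 * (Nat.log 2 n + 1) ∧ HasEFOfSize (cardMatchingPolytope n ℓ) r := by
  rcases Nat.eq_zero_or_pos ℓ with rfl | hℓ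
  · refine ⟨0, Nat.zero_le _, ?_⟩
    rw [cardMatchingPolytope_zero]
    exact (hasPointedEFOfSize_singleton (0 : KEdge n → ℝ)).hasEFOfSize
  rcases Nat.eq_zero_or_pos n with rfl | hn
  · refine ⟨0, Nat.zero_le _, ?_⟩
    rw [cardMatchingPolytope_eq_empty (by norm_num) hℓ]
    exact hasEFOfSize_empty
  obtain ⟨r, hr, hEF⟩ := hasEFOfSize_cardMatchingPolytope n ℓ
  refine ⟨r, hr.trans ?_, hEF⟩
  set L := Nat.log 2 n + 1
  have h1 : 2 * ℓ ≤ 2 ^ ℓ := by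
    obtain ⟨m, rfl⟩ : ∃ m, ℓ = m + 1 := ⟨ℓ - 1, by omega⟩
    have := (Nat.lt_two_pow_self : m < 2 ^ m)
    rw [pow_succ]; omega
  have h2 : n ^ 2 + 4 * ℓ + 4 ^ ℓ + 2 ≤ 3 * 4 ^ ℓ * n ^ 2 := by
    have hsq : 1 ≤ n ^ 2 := Nat.one_le_pow _ _ hn
    have h3 := four_mul_add_three_le ℓ hℓ
    nlinarith
  have h3 : 3 * (9 ^ ℓ * 2 ^ ℓ * 4 ^ ℓ) ≤ 2 ^ (9 * ℓ) := by
    rw [← mul_pow, ← mul_pow, pow_mul]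
    norm_num
    calc 3 * 72 ^ ℓ ≤ 3 ^ ℓ * 72 ^ ℓ := Nat.mul_le_mul_right _ (by
            calc 3 = 3 ^ 1 := by norm_num
              _ ≤ 3 ^ ℓ := Nat.pow_le_pow_right (by norm_num) hℓ)
      _ = 216 ^ ℓ := by rw [← mul_pow]; norm_num
      _ ≤ 512 ^ ℓ := Nat.pow_le_pow_left (by norm_num) ℓ
  calc 9 ^ ℓ * (2 * ℓ) * L * (n ^ 2 + 4 * ℓ + 4 ^ ℓ + 2)
      ≤ 9 ^ ℓ * 2 ^ ℓ * L * (3 * 4 ^ ℓ * n ^ 2) := by gcongr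
    _ = 3 * (9 ^ ℓ * 2 ^ ℓ * 4 ^ ℓ) * n ^ 2 * L := by ring
    _ ≤ 2 ^ (9 * ℓ) * n ^ 2 * L := by gcongr

/-- **Kaibel–Pashkovich–Theis 2012, Corollary 15 — compact extended formulations for `ℓ = O(log n)`:**
if `ℓ ≤ c·⌊log₂ n⌋` then `xc(P^ℓ_match(n)) ≤ n^{9c+3}`.  (By their Theorem 9 / Corollary 10 (p0011), via
Yannakakis 1991 and Bochert's theorem on primitive permutation groups, NO compact SYMMETRIC extended
formulation of `P^ℓ_match(n)` exists for `ℓ = Θ(log n)` — "symmetry matters"; that lower bound is not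
formalised here.) [cite: KaibelPashkovichTheis2012, Cor. 15 (p0016)] -/
theorem KaibelPashkovichTheis2012_cor15 (c n ℓ : ℕ) (hℓ : ℓ ≤ c * Nat.log 2 n) :
    ∃ r : ℕ, r ≤ n ^ (9 * c + 3) ∧ HasEFOfSize (cardMatchingPolytope n ℓ) r := by
  obtain ⟨r, hr, hEF⟩ := KaibelPashkovichTheis2012_thm14 n ℓ
  refine ⟨r, hr.trans ?_, hEF⟩
  rcases Nat.eq_zero_or_pos n with rfl | hn
  · simp
  have hlog : 2 ^ Nat.log 2 n ≤ n := Nat.pow_log_le_self 2 hn.ne'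
  have hL : Nat.log 2 n + 1 ≤ n := Nat.log_lt_self 2 hn.ne'
  calc 2 ^ (9 * ℓ) * n ^ 2 * (Nat.log 2 n + 1) ≤ 2 ^ (9 * (c * Nat.log 2 n)) * n ^ 2 * n := by
        gcongr
        · norm_num
    _ = (2 ^ Nat.log 2 n) ^ (9 * c) * n ^ 3 := by
        rw [← pow_mul]; ring_nf
    _ ≤ n ^ (9 * c) * n ^ 3 := by gcongr
    _ = n ^ (9 * c + 3) := by rw [← pow_add]

end CardMatchingEF

end Literature.Combinatorics.Optimization

end
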